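import Literature.MathematicalPhysics.QuantumFieldTheory.BalabanImbrieJaffe1984to88.BIJ88Ineq5113Covering
import Literature.MathematicalPhysics.QuantumFieldTheory.Dimock2011to13.TreeGraphSummation

/-!
# `BalabanImbrieJaffe1984to88.BIJ88W6PrimeBound` — T. Bałaban, J. Imbrie, A. Jaffe, *Effective action and cluster properties
of the abelian Higgs model*, Commun. Math. Phys. **114** (1988) 257–315 [BalabanImbrieJaffe1988]: Sect. 5.14, p. 310 —
the *"standard exercise"* bound **|W₆^{(k)′}(X)| ≤ (e^β(L^kε/ε₀)^{1/4−α})^{n̄+1+β′|X|}** on the remainder activities of the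
perturbation expansion, W₆^{(k)′}(X) MODELLED CONCRETELY from the printed connected-graph formula (clusters filling `X`,
truncation by connected graphs of overlap lines, the sum over the derivative slots `{γ_j}`, the `∫₀¹dt (1−t)^n̄/(n̄+1)!` of
(5.14.2)) over connected unions of cubes, and the bound PROVED from activity bounds of the printed shape (5.14.4), with
the printed *"adjustments in β, α, β′"* made explicit

HONEST FRAMING (cell `lit-balaban`, verbatim): statement-level skeleton of published theorems with citation tags; proofs where landed; nothing here is a claim about the Yang–Mills mass gap.

PDF held: `paper:balaban1988-cmp114-bij-abelian-higgs-effective-action` (journal page = PDF page + 256); pp. 308–310 = PDF pp.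
52–54 read this session as images (x2 renders `original-p052/053/054-x2.png`, seat folder `renders/`; r16's render of p. 308) and
against the typed row leaves `BIJ88Sect5StatementsPart2.Ineq5144` / `IneqW6'` (r16, reviewed p240155).

CITATION HEADER (verbatim).  p. 308 [PDF 52], (5.14.2): *"and a remainder ℛ_k(Λ₁₂^{(k)}) = ∫₀¹ dt −((1−t)^n̄/(n̄+1)!)
⟨d/dt; …; d/dt⟩_t. (5.14.2) … We express each d/dt as a sum Σ_γ (d/dt)_γ, where (d/dt)_γ acts only on the t before a
particular term V^{(k)}(Y) in Ṽ^{(k)} or in a particular χ-factor. … Let H ⊂ {1, …, n̄+1} specify which observables are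
included in one of the integrals."*  p. 309 [PDF 53], (5.14.3)–(5.14.4): *"⟨Π_{j∈H}(d/dt)_{γ_j} χ′_{Λ₁₂,t} e^{−tṼ^{(k)}(Λ₁₂)}⟩_{1,Λ₁₂}
= Σ_{{X_β} filling Λ₁₂} Π_β g₃(H_β, X_β). (5.14.3) Here H_β ⊂ H specifies which (d/dt)_{γ_j} have supports intersecting X_β. …
Let us drop the prime, and prove that |g₃(H_β, X_β)| ≤ (e^β(L^kε/ε₀)^{1/4−α})^{[|H_β| + β′|X_β∖H_β|]}. (5.14.4) We use X_β∖H_β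
to denote the set of cubes with no (d/dt)_{γ_j} factors, j ∈ H_β. … Each X_γ must cover and connect all the t-derivatives
specified by H_γ. … We insert factors u(X, Y) = 0 if X, Y overlap, 1 if X, Y do not overlap,"*  p. 310 [PDF 54]: *"and
similarly factors u(X₁,X₂), u(Y₁,Y₂). … We put u = 1 + a and expand in the usual manner. This enables us to factor out the
normalization z_t(Λ₁₂^{(k)}) to obtain ⟨Π_{j∈H}(d/dt)_{γ_j}⟩_t = Σ_{{H_γ}∈𝒫(H)} Σ_{{X_γ}} Σ_{(Y₁,…,Y_B)} (1/B!) Σ_G Π_{ℒ∈G} a(ℒ)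
Π_γ g₃(H_γ,X_γ) Π_{δ=1}^B g₃(∅,Y_δ). Here ℒ denotes pairs of clusters (lines) and G runs over graphs of such lines in which each
Y_δ is connected directly or indirectly to some X_γ. … Thus we have a formula ⟨Π_{j∈H}[;(d/dt)_{γ_j}]⟩_t = [the same] ×
(1/B!) Σ_{G_c} Π_{ℒ∈G_c} a(ℒ) Π_γ g₃(H_γ,X_γ) Π_{δ=1}^B g₃(∅,Y_δ), where G_c runs over connected graphs involving all clusters
X_γ, Y_δ, and hence all of H. We use this to give an expansion for the remainder from the perturbation expansion of the
interaction: ℛ_k(Λ₁₂^{(k)}) = Σ_{X⊂Λ₁₂^{(k)}} W₆^{(k)′}(X). Here W₆^{(k)′}(X) is obtained by summing only over {X_γ}, (Y₁, …, Y_B)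
which fill X, summing over {γ_j} with suppt(d/dt)_{γ_j} ⊂ X, and integrating over t as in (5.14.2). It is now a standard
exercise to estimate the expansion, using (5.14.4). The result is |W₆^{(k)′}(X)| ≤ (e^β(L^kε/ε₀)^{1/4−α})^{n̄+1+β′|X|}. (We
allow adjustments in β, α, β′, keeping them small.)"*  (p. 289: *"X's are arbitrary connected unions of r(e_k)-cubes"*.)

WHAT IS REPRODUCED (unit `lit-balaban-p25`, generation 5 of the Phase-2 proof seat p25; SKELETON row `C2.Claim@310` of
`HOME/lit-balaban-r16/ROWS-C2-part2.md`, typed as the abstract `Prop` leaf `BIJ88Sect5StatementsPart2.IneqW6'` over r16's schematic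
`PolymerSys` (ref-1 F6); HOME `run/shared/lean/pub/lit-balaban/lit-balaban-p25/`).  The *"standard exercise"*, DONE:
§1 THE MODEL of W₆′.  Cubes `V` with an adjacency `R` (symmetric, degree `≤ Δ`); polymers inside `X` = nonempty `R`-connected
`Y ⊆ X` (`BIJ88Ineq5113Covering.polys`, the gen-3 carrier; r16's `PolymerSys` instantiated by `cubeSys V = (Finset V, card)`).
Derivative slots `H = {1,…,n̄+1}` = `Fin (n̄+1)`; the *"particular term or χ-factor"* hit by `(d/dt)_γ` is a target `γ ∈ Γ`
localized in the cube `loc γ` (READING (i) below); an assignment `γ : H → Γ` with `loc γ_j ∈ X` (`assignments`).  The truncated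
function `⟨Π_{j∈H}[;(d/dt)_{γ_j}]⟩_t` restricted to the clusters filling `X` is `trunc` = `Σ'_n term n`, where the term with
`n+1` clusters (`term`) is the printed sum in ORDERED form: `(1/(n+1)!) Σ_{Z ∈ polys(X)^{n+1}} Σ_{f : H → Fin(n+1)} [⋃_i Z_i = X,
loc γ_j ∈ Z_{f j} ∀ j] ρ^T(Z) Π_i g₃ᵗ(γ, f⁻¹(i), Z_i)` — the labelled clusters `(H_γ, X_γ)` are the `(f⁻¹(i), Z_i)` with
non-empty fibre, the `Y_δ` are the `Z_i` with empty fibre in their order, and the printed weight `1/B!` is `(n+1)!/B!` (the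
number of placements of the labelled clusters among `n+1` ordered slots) times `1/(n+1)!` (READING (iv)); the printed
`Σ_{G_c} Π_{ℒ∈G_c} a(ℒ)` (`a = u − 1 ∈ {0, −1}`) IS the hard-core Ursell coefficient `ρ^T` of the overlap graph of the clusters
(the tree's `Dimock2011to13.UrsellTreeGraphBound.rhoT`; `rhoT_eq_sum_connected_graphs` below re-exports its identification with
the connected-graph sum); `W6' X = ∫₀¹ dt (−(1−t)^n̄/(n̄+1)!) Σ_{γ ∈ assignments X} trunc t γ X` as printed.
§2 THE ACTIVITY INPUT (5.14.4) in the model's letters: `|g₃ᵗ(γ, K, Y)| ≤ θ^{|K| + β′|Y ∖ loc(γ(K))|}` for `t ∈ [0,1]` whenever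
`Y` covers the cubes `loc γ_j`, `j ∈ K` (θ := the printed vertex factor `e^β(L^kε/ε₀)^{1/4−α}`, `e` the charge and `β > 0` a
small power — cf. HOME/GAPS.md G-C2-p36-04 — here a free parameter `0 < θ ≤ 1`); also accepted verbatim as r16's leaf
`Ineq5144 (cubeSys V) …` (`hyp_of_ineq5144`).
§3–§6 THE ESTIMATE, PROVED (`abs_W6'_le`): for `0 < θ ≤ 1`, `0 ≤ β′`, at most `G` targets per cube and the smallness
`16(Δ+1)² e² θ^{β′/2} ≤ 1`:  `|W₆′(X)| ≤ 4e²θ^{β′/2}·G^{n̄+1}·|X|^{n̄+2} · θ^{(1−β′)(n̄+1)} · θ^{(β′/2)|X|}`.  Route = the exercise: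
(a) per cluster `θ^{|K|+β′|Z∖loc K|} ≤ θ^{(1−β′)|K|}θ^{β′|Z|}` (`|Z ∖ loc K| ≥ |Z| − |K|`), and `Σ_i |f⁻¹(i)| = n̄+1` gives the
factor `θ^{(1−β′)(n̄+1)}` (`prod_abs_g3_le`); (b) filling `⋃ Z_i = X` gives `Σ|Z_i| ≥ |X|`, whence `θ^{(β′/2)|X|}` and a weight
`θ^{(β′/2)|Z_i|}` left per cluster (`rpow_fill_le`); (c) the number of labellings `f` with `loc γ_j ∈ Z_{f j}` is `Π_j #{i : loc γ_j
∈ Z_i} ≤ (Σ_i|Z_i|)^{n̄+1} ≤ (n̄+1)!·Π_i e^{|Z_i|}` (`card_labellings_le`), cancelling the `1/(n̄+1)!` of (5.14.2); (d) PENROSE'S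
TREE-GRAPH INEQUALITY `|ρ^T| ≤ #{spanning trees of the overlap graph}` and the summation over tuples compatible with a tree,
vertex by vertex — the tree's `Dimock2011to13.TreeGraphSummation.hstar_partialSum_le` ([Dimock2013] App. B step 4, kernel form) —
fed by the ANCHORED NORM `Σ_{Z∋q, Z⊆X connected} (θ^{β′/2}e²)^{|Z|} ≤ 2e²θ^{β′/2} =: Φ ≤ 1/8` from the tree's lattice-animal lemma
`LatticeModels.sum_pow_card_le_of_connected` (`anchored_norm_le`): every partial sum of `Σ_n (1/(n+1)!) Σ_Z |ρ^T(Z)| Π_i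
θ^{(β′/2)|Z_i|}e^{|Z_i|}` is `≤ 2Φ|X|` (`partialSum_le`), so `trunc` converges absolutely and `|trunc t γ X| ≤ (n̄+1)!·2Φ|X|·
θ^{(1−β′)(n̄+1)}θ^{(β′/2)|X|}` (`summable_abs_term`, `abs_trunc_le`); (e) `#assignments X ≤ (G|X|)^{n̄+1}` (`card_assignments_le`);
(f) `|∫₀¹(1−t)^n̄/(n̄+1)! (…)dt| ≤ sup/(n̄+1)!` with NO integrability assumption (`intervalIntegral.norm_integral_le_of_norm_le_const`).
§7 THE PRINTED SHAPE.  Absorbing the polynomial prefactor into `θ^{−(β′/4)|X|}` (`x^m e^{−cx} ≤ m!/c^m`): for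
`4e²θ^{β′/2}G^{n̄+1}(n̄+2)! ≤ ((β′/4)log θ⁻¹)^{n̄+2}`,  `|W₆′(X)| ≤ θ^{(1−β′)(n̄+1) + (β′/4)|X|}` (`abs_W6'_le_rpow`), i.e. r16's typed
leaf VERBATIM with the adjusted constants: `IneqW6' (cubeSys V) W₆′ (θ^{1−β′}) (β′/(4(1−β′))) n̄` for `0 < β′ < 1` (`ineqW6'_holds`:
`(θ^{1−β′})^{n̄+1+(β′/(4(1−β′)))|X|} = θ^{(1−β′)(n̄+1)+(β′/4)|X|}`) — the printed *"adjustments in α"* (θ ↦ θ^{1−β′}, i.e. `1/4−α ↦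
(1−β′)(1/4−α)`, `β ↦ (1−β′)β`) *"and β′"* (`β′ ↦ β′/(4(1−β′))`); and `exists_theta0`: for every `Δ, G, n̄` and `0 < β′ < 1` an explicit
`θ₀ > 0` below which both smallness conditions hold, so that the leaf holds for EVERY model datum obeying (5.14.4) at a vertex factor
`θ ≤ θ₀`.
READINGS (declared; reading notes for the fold owner r16, HOME/GAPS.md G-C2-p25-02).  (i) The support of `(d/dt)_γ` is read as ONE
`r(e_k)`-cube `loc γ` — the χ-factors are per site or bond; for a term `V^{(k)}(Y)` the model records one cube of `Y`: with a multi-cube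
support counted among the *"cubes with (d/dt) factors"*, (5.14.4) alone gives no decay in `|Y|` and does not control the sum over
`{γ_j}` — that needs the `e^{−cr(e_k)|Y|}` smallness of `V^{(k)}(Y)` ((5.4.7)–(5.7.x)), which the print's *"standard exercise"* leaves
implicit.  (ii) At most `G` targets per cube (paper: `G ≈ 2r(e_k)^d` sites/bonds per cube, a polylogarithm of `e_k`; the factor
`G^{n̄+1}` is absorbed by the α-adjustment since θ is a power of `L^kε`) — here `G` is a parameter of the smallness condition.  (iii) The
printed exponent `n̄+1` is reached from (5.14.4) AS PRINTED only as `(1−β′)(n̄+1)`: a cube hosting a derivative pays `θ` per derivative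
but no `θ^{β′}` (it is excluded from `X_β∖H_β`), so for the one-cluster term with the `n̄+1` derivatives in distinct cubes of `X`
(5.14.4) offers `θ^{(n̄+1)+β′(|X|−n̄−1)} = θ^{(1−β′)(n̄+1)+β′|X|}` and no more — whence the α-adjustment `θ ↦ θ^{1−β′}` of the
output, which the print allows.  (iv) Ordered
re-indexing of the printed `Σ_{{H_γ}∈𝒫(H)} Σ_{{X_γ}} Σ_{(Y₁,…,Y_B)} (1/B!)`: a set partition `{H_γ}` with `m` blocks, its clusters
and an ordered `B`-tuple correspond to exactly `(m+B)!/B!` pairs `(Z, f)` (an injection of the blocks into the `m+B` slots; the `Y_δ`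
fill the remaining slots in order), each weighted `1/(m+B)!` here — the same total weight `1/B!`; `ρ^T` and the product are invariant
under the slot permutation.  (v) `t`-dependence of `g₃` is a parameter; the bound is required on `[0,1]` only; no measurability or
integrability of `t ↦ g₃ᵗ` is assumed (a non-integrable integrand has integral `0` by convention and the bound holds a fortiori).
All hypotheses are explicit binders; 0 new `Prop` facts; nothing of the paper beyond the cited displays is asserted; the regions
`Λ₁₂^{(k)}` enter only as the ambient cube set `X ⊆ Λ₁₂`.  Engine credits: [Dimock2013] App. B (cell `b2b-balaban` template files
`Dimock2011to13.{UrsellTreeGraphBound, TreeGraphSummation}`), the tree's `LatticeModels.PolymerGasGeometric`.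
-/

noncomputable section

open Finset MeasureTheory
open Literature.Probability.LatticeModels (IsRConnected sum_pow_card_le_of_connected)
open Literature.MathematicalPhysics.QuantumFieldTheory.BalabanImbrieJaffe1984to88.BIJ88Ineq5113Covering
  (polys mem_polys nonempty_of_mem_polys one_le_card_of_mem_polys singleton_mem_polys cubeSys cubeSys_card)
open Literature.MathematicalPhysics.QuantumFieldTheory.Dimock2011to13.UrsellTreeGraphBound (rhoT overlapGraph
  rhoT_eq_sum_graphs rhoT_singleton)
open Literature.MathematicalPhysics.QuantumFieldTheory.Dimock2011to13.TreeGraphSummation (hstar_partialSum_le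
  vertexHyp_of_anchored rootHyp_of_anchored)
open Literature.MathematicalPhysics.QuantumFieldTheory.Dimock2011to13.MayerExpansion (IsConnColl)
open Literature.MathematicalPhysics.QuantumFieldTheory.Dimock2011to13.UrsellConnectedGraphSum (pairs zetaSubOne Adj)

namespace Literature.MathematicalPhysics.QuantumFieldTheory.BalabanImbrieJaffe1984to88.BIJ88W6PrimeBound

variable {V : Type} [DecidableEq V] {T : Type}

/-! ## §1 The model of W₆^{(k)′}(X) (p. 310) -/

section Model

variable (R : V → V → Prop) (nbar : ℕ) (Γ : Finset T) (loc : T → V)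
  (g₃ : ℝ → (Fin (nbar + 1) → T) → Finset (Fin (nbar + 1)) → Finset V → ℝ)

/-- The block `H_γ = f⁻¹(i) ⊂ H` of the derivative slots carried by the `i`-th cluster under a labelling `f : H → slots`
(p. 310: *"{H_γ} ∈ 𝒫(H)"*; the blocks of the ordered re-indexing, READING (iv)). [cite: BalabanImbrieJaffe1988, p.310 (Sect. 5.14)] -/
def fiber {n : ℕ} (f : Fin (nbar + 1) → Fin n) (i : Fin n) : Finset (Fin (nbar + 1)) := univ.filter fun j => f j = i

/-- Admissibility of an ordered cluster family `Z` with labelling `f` for the polymer `X` and the assignment `γ`: the clusters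
FILL `X` (*"summing only over {X_γ}, (Y₁, …, Y_B) which fill X"*) and each derivative sits in its cluster (*"Each X_γ must cover
… all the t-derivatives specified by H_γ"*, p. 309). [cite: BalabanImbrieJaffe1988, p.310 (Sect. 5.14)] -/
def Adm (γ : Fin (nbar + 1) → T) (X : Finset V) {n : ℕ} (Z : Fin n → Finset V) (f : Fin (nbar + 1) → Fin n) : Prop :=
  univ.biUnion Z = X ∧ ∀ j, loc (γ j) ∈ Z (f j)

/-- Admissibility is decidable (finite conditions). [cite: BalabanImbrieJaffe1988, p.310 (Sect. 5.14)] -/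
instance instDecidableAdm (γ : Fin (nbar + 1) → T) (X : Finset V) {n : ℕ} (Z : Fin n → Finset V)
    (f : Fin (nbar + 1) → Fin n) : Decidable (Adm nbar loc γ X Z f) := by
  unfold Adm; infer_instance

/-- The term of `⟨Π_{j∈H}[;(d/dt)_{γ_j}]⟩_t` (p. 310, second display) with `n+1` clusters, restricted to the families filling
`X`, in ordered form (READING (iv)): `(1/(n+1)!) Σ_{Z ∈ polys(X)^{n+1}} Σ_{f : H → Fin(n+1)} [Adm] ρ^T(Z) Π_i g₃ᵗ(γ, f⁻¹(i), Z_i)`;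
`ρ^T(Z) = Σ_{G_c} Π_{ℒ∈G_c} a(ℒ)` is the hard-core Ursell coefficient of the overlap graph of the clusters
(`rhoT_eq_sum_connected_graphs`). [cite: BalabanImbrieJaffe1988, p.310 (Sect. 5.14)] -/
def term (t : ℝ) (γ : Fin (nbar + 1) → T) (X : Finset V) (n : ℕ) : ℝ :=
  (1 / ((n + 1).factorial : ℝ)) *
    ∑ Z ∈ Fintype.piFinset (fun _ : Fin (n + 1) => polys R X), ∑ f : Fin (nbar + 1) → Fin (n + 1),
      if Adm nbar loc γ X Z f then (rhoT Z univ : ℝ) * ∏ i, g₃ t γ (fiber nbar f i) (Z i) else 0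

/-- The truncated function `⟨Π_{j∈H}[;(d/dt)_{γ_j}]⟩_t` summed over the cluster families filling `X` (all numbers of
clusters: the series over `n`). [cite: BalabanImbrieJaffe1988, p.310 (Sect. 5.14)] -/
def trunc (t : ℝ) (γ : Fin (nbar + 1) → T) (X : Finset V) : ℝ := ∑' n, term R nbar loc g₃ t γ X n

/-- The assignments `{γ_j}_{j∈H}` of the `n̄+1` derivative slots to targets localized in `X` (*"summing over {γ_j} with
suppt(d/dt)_{γ_j} ⊂ X"*). [cite: BalabanImbrieJaffe1988, p.310 (Sect. 5.14)] -/
def assignments (X : Finset V) : Finset (Fin (nbar + 1) → T) :=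
  Fintype.piFinset fun _ : Fin (nbar + 1) => Γ.filter fun τ => loc τ ∈ X

/-- **W₆^{(k)′}(X)** (p. 310): *"W₆^{(k)′}(X) is obtained by summing only over {X_γ}, (Y₁, …, Y_B) which fill X, summing over
{γ_j} with suppt(d/dt)_{γ_j} ⊂ X, and integrating over t as in (5.14.2)"*, (5.14.2) = `∫₀¹ dt −((1−t)^n̄/(n̄+1)!) ⟨d/dt;…;d/dt⟩_t`.
[cite: BalabanImbrieJaffe1988, p.310 (Sect. 5.14)] -/
def W6' (X : Finset V) : ℝ :=
  ∫ t in (0 : ℝ)..1, (-((1 - t) ^ nbar / ((nbar + 1).factorial : ℝ))) *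
    ∑ γ ∈ assignments nbar Γ loc X, trunc R nbar loc g₃ t γ X

variable {R nbar Γ loc g₃}

open Classical in
/-- The printed `Σ_{G_c} Π_{ℒ∈G_c} a(ℒ)` (*"G_c runs over connected graphs involving all clusters"*, `a = u − 1`, `u(X,Y) = 0`
if `X, Y` overlap and `1` otherwise): the coefficient `ρ^T(Z)` used in `term` equals the sum over ALL connected graphs `G_c` on the
cluster indices of `Π_{ℒ∈G_c} a(ℒ)` with `a(ℒ) = −1` for an overlapping pair and `0` otherwise (the tree's
`UrsellTreeGraphBound.rhoT_eq_sum_graphs`, [Dimock2013] App. B). [cite: BalabanImbrieJaffe1988, p.310 (Sect. 5.14)] -/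
theorem rhoT_eq_sum_connected_graphs {n : ℕ} (Z : Fin (n + 1) → Finset V) :
    rhoT Z univ = ∑ G ∈ (pairs (univ : Finset (Fin (n + 1)))).powerset with IsConnColl (Adj G) univ,
      ∏ e ∈ G, zetaSubOne (overlapGraph Z) univ e :=
  rhoT_eq_sum_graphs Z univ_nonempty

/-- Membership in `assignments`. [cite: BalabanImbrieJaffe1988, p.310 (Sect. 5.14)] -/
theorem mem_assignments {X : Finset V} {γ : Fin (nbar + 1) → T} :
    γ ∈ assignments nbar Γ loc X ↔ ∀ j, γ j ∈ Γ ∧ loc (γ j) ∈ X := by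
  simp [assignments, Fintype.mem_piFinset]

/-- `Σ_i |f⁻¹(i)| = |H| = n̄ + 1`: every derivative slot lies in exactly one block. [cite: BalabanImbrieJaffe1988, p.310 (Sect. 5.14)] -/
theorem sum_card_fiber {n : ℕ} (f : Fin (nbar + 1) → Fin n) : ∑ i, (fiber nbar f i).card = nbar + 1 := by
  have h := (card_eq_sum_card_fiberwise (f := f) (s := (univ : Finset (Fin (nbar + 1)))) (t := univ)
    fun _ _ => mem_coe.2 (mem_univ _)).symm
  simpa [fiber] using h

/-- SANITY OF THE MODEL (the one-cluster term): for a connected `X` carrying all the derivative cubes, the term with one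
cluster is the single activity `g₃ᵗ(γ, H, X)` (`Z₀ = X`, `f ≡ 0`, `ρ^T(X) = 1`, weight `1/1!`) — the `B = 0`, `{H_γ} = {H}` term of
the printed sum. [cite: BalabanImbrieJaffe1988, p.310 (Sect. 5.14)] -/
theorem term_zero {t : ℝ} {γ : Fin (nbar + 1) → T} {X : Finset V} (hX : IsRConnected R X)
    (hγ : ∀ j, loc (γ j) ∈ X) : term R nbar loc g₃ t γ X 0 = g₃ t γ univ X := by
  classical
  have hXmem : X ∈ polys R X := mem_polys.2 ⟨Subset.rfl, hX⟩
  have huniv1 : (univ : Finset (Fin (0 + 1))) = {0} := by decide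
  have hunivF : (univ : Finset (Fin (nbar + 1) → Fin (0 + 1))) = {fun _ => 0} := by
    ext f
    simp only [mem_univ, mem_singleton, true_iff]
    exact funext fun j => Fin.eq_zero (f j)
  unfold term
  have hfac : (1 / ((0 + 1).factorial : ℝ)) = 1 := by norm_num [Nat.factorial]
  rw [hfac, one_mul, Finset.sum_eq_single (fun _ => X)]
  · rw [hunivF, sum_singleton]
    have hA : Adm nbar loc γ X (fun _ : Fin (0 + 1) => X) (fun _ => 0) := by
      refine ⟨?_, fun j => hγ j⟩
      rw [huniv1, singleton_biUnion]
    rw [if_pos hA]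
    have hfib : fiber nbar (fun _ : Fin (nbar + 1) => (0 : Fin (0 + 1))) 0 = univ := by
      ext j; simp [fiber]
    have hρ : rhoT (fun _ : Fin (0 + 1) => X) univ = 1 := by
      rw [huniv1]; exact rhoT_singleton _ _
    rw [hρ, Int.cast_one, one_mul, huniv1, prod_singleton, hfib]
  · intro Z _ hne
    have hnot : ∀ f, ¬ Adm nbar loc γ X Z f := by
      intro f hA
      apply hne
      funext i
      have hi : i = 0 := Fin.eq_zero i
      subst hi
      have h := hA.1
      rwa [huniv1, singleton_biUnion] at h
    exact sum_eq_zero fun f _ => if_neg (hnot f)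
  · intro h
    exact absurd (Fintype.mem_piFinset.2 fun _ => hXmem) h

end Model

/-! ## §2 Elementary real-analysis helpers -/

section Helpers

/-- `Π_{i∈s} θ^{a_i} = θ^{Σ a_i}` for `θ > 0`. [folklore] -/
private theorem prod_rpow_eq_rpow_sum {ι : Type*} {θ : ℝ} (hθ : 0 < θ) (s : Finset ι) (a : ι → ℝ) :
    ∏ i ∈ s, θ ^ a i = θ ^ ∑ i ∈ s, a i := by
  classical
  induction s using Finset.induction_on with
  | empty => simp
  | insert i s hi ih => rw [prod_insert hi, sum_insert hi, ih, Real.rpow_add hθ]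

/-- `x^m e^{−cx} ≤ m!/c^m` for `x ≥ 0`, `c > 0` (from `y^m/m! ≤ e^y`). [folklore] -/
private theorem pow_mul_exp_neg_le {x c : ℝ} (hx : 0 ≤ x) (hc : 0 < c) (m : ℕ) :
    x ^ m * Real.exp (-(c * x)) ≤ m.factorial / c ^ m := by
  have h := Real.pow_div_factorial_le_exp _ (mul_nonneg hc.le hx) m
  rw [mul_pow, div_le_iff₀ (by positivity)] at h
  rw [Real.exp_neg, ← div_eq_mul_inv, div_le_div_iff₀ (Real.exp_pos _) (by positivity)]
  nlinarith [h]

end Helpers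

/-! ## §3 Step (a)–(b): the activity product along a labelled filling -/

section Activity

variable {R : V → V → Prop} {nbar : ℕ} {loc : T → V}
  {g₃ : ℝ → (Fin (nbar + 1) → T) → Finset (Fin (nbar + 1)) → Finset V → ℝ} {θ β' : ℝ}

/-- Step (a), one cluster: from (5.14.4) `|g₃(K, Z)| ≤ θ^{|K| + β′|Z ∖ loc K|}` and `|Z ∖ loc K| ≥ |Z| − |K|` (the derivative
cubes are at most `|K|`): `|g₃(K,Z)| ≤ θ^{(1−β′)|K| + β′|Z|}` (`0 < θ ≤ 1`, `β′ ≥ 0`). [cite: BalabanImbrieJaffe1988, (5.14.4) p.309] -/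
theorem abs_g3_le_rpow (hθ0 : 0 < θ) (hθ1 : θ ≤ 1) (hβ : 0 ≤ β') {t : ℝ} {γ : Fin (nbar + 1) → T}
    {K : Finset (Fin (nbar + 1))} {Z : Finset V}
    (h : |g₃ t γ K Z| ≤ θ ^ ((K.card : ℝ) + β' * ((Z \ K.image fun j => loc (γ j)).card : ℝ))) :
    |g₃ t γ K Z| ≤ θ ^ ((1 - β') * K.card + β' * Z.card) := by
  refine h.trans (Real.rpow_le_rpow_of_exponent_ge hθ0 hθ1 ?_)
  have hc : ((Z.card : ℝ) - K.card) ≤ ((Z \ K.image fun j => loc (γ j)).card : ℝ) := by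
    have h1 : Z.card ≤ (Z \ K.image fun j => loc (γ j)).card + (K.image fun j => loc (γ j)).card := by
      calc Z.card ≤ (Z \ K.image (fun j => loc (γ j)) ∪ K.image fun j => loc (γ j)).card :=
            card_le_card (by intro x hx; by_cases hm : x ∈ K.image (fun j => loc (γ j)) <;> simp [hx, hm])
        _ ≤ _ := card_union_le _ _
    have h2 : (K.image fun j => loc (γ j)).card ≤ K.card := card_image_le
    have h3 : (Z.card : ℝ) ≤ ((Z \ K.image fun j => loc (γ j)).card : ℝ) + (K.card : ℝ) := by
      exact_mod_cast h1.trans (Nat.add_le_add_left h2 _)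
    linarith
  nlinarith

/-- Steps (a)–(b) along a labelled family: if every derivative cube `loc γ_j` lies in its cluster `Z_{f j}` and (5.14.4) holds
for the pairs `(f⁻¹(i), Z_i)`, then `Π_i |g₃ᵗ(γ, f⁻¹(i), Z_i)| ≤ θ^{(1−β′)(n̄+1)} · θ^{β′ Σ_i |Z_i|}`.
[cite: BalabanImbrieJaffe1988, (5.14.4) p.309] -/
theorem prod_abs_g3_le (hθ0 : 0 < θ) (hθ1 : θ ≤ 1) (hβ : 0 ≤ β') {t : ℝ} {γ : Fin (nbar + 1) → T} {n : ℕ}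
    {Z : Fin n → Finset V} {f : Fin (nbar + 1) → Fin n}
    (h : ∀ i, |g₃ t γ (fiber nbar f i) (Z i)| ≤
      θ ^ (((fiber nbar f i).card : ℝ) + β' * ((Z i \ (fiber nbar f i).image fun j => loc (γ j)).card : ℝ))) :
    ∏ i, |g₃ t γ (fiber nbar f i) (Z i)| ≤
      θ ^ ((1 - β') * (nbar + 1)) * θ ^ (β' * ∑ i, ((Z i).card : ℝ)) := by
  calc ∏ i, |g₃ t γ (fiber nbar f i) (Z i)|
      ≤ ∏ i, θ ^ ((1 - β') * (fiber nbar f i).card + β' * (Z i).card) :=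
        prod_le_prod (fun i _ => abs_nonneg _) fun i _ => abs_g3_le_rpow hθ0 hθ1 hβ (h i)
    _ = θ ^ ∑ i, ((1 - β') * (fiber nbar f i).card + β' * (Z i).card) := prod_rpow_eq_rpow_sum hθ0 _ _
    _ = θ ^ ((1 - β') * (nbar + 1)) * θ ^ (β' * ∑ i, ((Z i).card : ℝ)) := by
        rw [← Real.rpow_add hθ0, sum_add_distrib, ← mul_sum, ← mul_sum]
        congr 2
        have := sum_card_fiber (nbar := nbar) f
        rw [← Nat.cast_sum, this]
        push_cast
        ring

/-- Step (b): a filling `⋃_i Z_i = X` has `Σ_i |Z_i| ≥ |X|`, so `θ^{β′Σ|Z_i|} ≤ θ^{(β′/2)|X|} · Π_i θ^{(β′/2)|Z_i|}` (`θ ≤ 1`).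
[cite: BalabanImbrieJaffe1988, p.310 (Sect. 5.14)] -/
theorem rpow_fill_le (hθ0 : 0 < θ) (hθ1 : θ ≤ 1) (hβ : 0 ≤ β') {n : ℕ} {Z : Fin n → Finset V} {X : Finset V}
    (hfill : univ.biUnion Z = X) :
    θ ^ (β' * ∑ i, ((Z i).card : ℝ)) ≤ θ ^ (β' / 2 * X.card) * ∏ i, θ ^ (β' / 2 * ((Z i).card : ℝ)) := by
  rw [prod_rpow_eq_rpow_sum hθ0, ← mul_sum, ← Real.rpow_add hθ0]
  refine Real.rpow_le_rpow_of_exponent_ge hθ0 hθ1 ?_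
  have hX : (X.card : ℝ) ≤ ∑ i, ((Z i).card : ℝ) := by
    rw [← hfill]
    exact_mod_cast card_biUnion_le
  have hS : 0 ≤ ∑ i, ((Z i).card : ℝ) := sum_nonneg fun _ _ => Nat.cast_nonneg _
  nlinarith

end Activity

/-! ## §4 Step (c): counting the labellings -/

section Labellings

variable {nbar : ℕ} {loc : T → V}

/-- Step (c): the labellings `f : H → Fin n` with `loc γ_j ∈ Z_{f j}` for all `j` number `Π_j #{i : loc γ_j ∈ Z_i} ≤ (Σ_i |Z_i|)^{n̄+1}
≤ (n̄+1)! · e^{Σ_i |Z_i|}` — the multiplicity of the ordered re-indexing against the `1/(n̄+1)!` of (5.14.2).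
[cite: BalabanImbrieJaffe1988, p.310 (Sect. 5.14)] -/
theorem card_labellings_le (γ : Fin (nbar + 1) → T) {n : ℕ} (Z : Fin n → Finset V) :
    (((univ : Finset (Fin (nbar + 1) → Fin n)).filter fun f => ∀ j, loc (γ j) ∈ Z (f j)).card : ℝ) ≤
      (nbar + 1).factorial * Real.exp (∑ i, ((Z i).card : ℝ)) := by
  classical
  set S : ℝ := ∑ i, ((Z i).card : ℝ) with hS
  have hS0 : 0 ≤ S := sum_nonneg fun _ _ => Nat.cast_nonneg _
  -- the admissible labellings are a product set
  have hset : ((univ : Finset (Fin (nbar + 1) → Fin n)).filter fun f => ∀ j, loc (γ j) ∈ Z (f j)) =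
      Fintype.piFinset fun j => univ.filter fun i => loc (γ j) ∈ Z i := by
    ext f
    simp [Fintype.mem_piFinset]
  have hfac : ∀ j : Fin (nbar + 1), ((univ.filter fun i => loc (γ j) ∈ Z i).card : ℝ) ≤ S := by
    intro j
    rw [hS, card_eq_sum_ones, Nat.cast_sum, sum_filter]
    push_cast
    refine sum_le_sum fun i _ => ?_
    split_ifs with h
    · exact_mod_cast card_pos.2 ⟨_, h⟩
    · exact Nat.cast_nonneg _
  calc (((univ : Finset (Fin (nbar + 1) → Fin n)).filter fun f => ∀ j, loc (γ j) ∈ Z (f j)).card : ℝ)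
      = ∏ j : Fin (nbar + 1), ((univ.filter fun i => loc (γ j) ∈ Z i).card : ℝ) := by
        rw [hset, Fintype.card_piFinset, Nat.cast_prod]
    _ ≤ ∏ _j : Fin (nbar + 1), S := prod_le_prod (fun _ _ => Nat.cast_nonneg _) fun j _ => hfac j
    _ = S ^ (nbar + 1) := by rw [prod_const, card_univ, Fintype.card_fin]
    _ ≤ (nbar + 1).factorial * Real.exp S := by
        have h := Real.pow_div_factorial_le_exp _ hS0 (nbar + 1)
        rwa [div_le_iff₀ (by positivity), mul_comm] at h

end Labellings

/-! ## §5 Step (d): Penrose's tree-graph inequality and the tuple summation (engine: [Dimock2013] App. B step 4) -/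

section Tuples

variable {R : V → V → Prop} {nbr : V → Finset V} {Δ : ℕ} {σ : ℝ}

/-- The weight left on a cluster after steps (a)–(c): `w(Z) = σ^{|Z|} e^{|Z|}`, `σ = θ^{β′/2}`.
[cite: BalabanImbrieJaffe1988, p.310 (Sect. 5.14)] -/
def wt (σ : ℝ) (Z : Finset V) : ℝ := σ ^ Z.card * Real.exp (Z.card : ℝ)

omit [DecidableEq V] in
/-- `w ≥ 0` for `σ ≥ 0`. [cite: BalabanImbrieJaffe1988, p.310 (Sect. 5.14)] -/
theorem wt_nonneg (hσ : 0 ≤ σ) (Z : Finset V) : 0 ≤ wt σ Z := mul_nonneg (pow_nonneg hσ _) (Real.exp_nonneg _)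

/-- THE ANCHORED NORM (the *"combinatoric factor"* of connected unions of cubes through a fixed cube): for `R` symmetric of
degree `≤ Δ` and `(Δ+1)²·σe² ≤ 1/2`, `Σ_{Z ∈ polys X, q ∈ Z} w(Z)e^{|Z|} = Σ (σe²)^{|Z|} ≤ 2σe²` (the tree's lattice-animal lemma
`LatticeModels.sum_pow_card_le_of_connected`). [cite: BalabanImbrieJaffe1988, p.310 (Sect. 5.14)] -/
theorem anchored_norm_le (hR : ∀ x y, R x y → R y x) (hΔ : ∀ x, (nbr x).card ≤ Δ) (hnbr : ∀ x y, R x y → y ∈ nbr x)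
    (hσ : 0 ≤ σ) (hsmall : ((Δ : ℝ) + 1) ^ 2 * (σ * Real.exp 2) ≤ 1 / 2) (X : Finset V) (q : V) :
    ∑ Z ∈ polys R X with q ∈ Z, wt σ Z * Real.exp (Z.card : ℝ) ≤ 2 * (σ * Real.exp 2) := by
  have hterm : ∀ Z : Finset V, wt σ Z * Real.exp (Z.card : ℝ) = (σ * Real.exp 2) ^ Z.card := by
    intro Z
    rw [wt, mul_pow, mul_assoc, ← Real.exp_add, ← Real.exp_nat_mul]
    congr 2
    ring
  simp_rw [hterm]
  exact sum_pow_card_le_of_connected hR hΔ hnbr (mul_nonneg hσ (Real.exp_nonneg _)) hsmall q _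
    fun Z hZ => ⟨(mem_filter.1 hZ).2, (mem_polys.1 (mem_filter.1 hZ).1).2⟩

/-- Step (d), PROVED by the tree's engine: with `Φ = 2σe² ≤ 1/8`, every partial sum of
`Σ_n (1/(n+1)!) Σ_{Z ∈ polys(X)^{n+1}} |ρ^T(Z)| Π_i w(Z_i)` is at most `2Φ|X|` — Penrose's tree-graph inequality
`|ρ^T| ≤ #{spanning trees of the overlap graph}` and the summation over the tuples compatible with a tree graph, vertex by vertex
(`Dimock2011to13.TreeGraphSummation.hstar_partialSum_le` with the anchored norm `anchored_norm_le`).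
[cite: BalabanImbrieJaffe1988, p.310 (Sect. 5.14)] -/
theorem partialSum_le (hR : ∀ x y, R x y → R y x) (hΔ : ∀ x, (nbr x).card ≤ Δ) (hnbr : ∀ x y, R x y → y ∈ nbr x)
    (hσ : 0 ≤ σ) (hsmall : 16 * ((Δ : ℝ) + 1) ^ 2 * (σ * Real.exp 2) ≤ 1) (X : Finset V) (N : ℕ) :
    ∑ n ∈ range N, (1 / ((n + 1).factorial : ℝ)) *
        ∑ Z ∈ Fintype.piFinset (fun _ : Fin (n + 1) => polys R X), |(rhoT Z univ : ℝ)| * ∏ i, wt σ (Z i) ≤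
      2 * (2 * (σ * Real.exp 2)) * X.card := by
  have hD : (1 : ℝ) ≤ ((Δ : ℝ) + 1) ^ 2 := by nlinarith [(Nat.cast_nonneg Δ : (0 : ℝ) ≤ Δ)]
  have hlam : 0 ≤ σ * Real.exp 2 := mul_nonneg hσ (Real.exp_nonneg _)
  have hsmall' : ((Δ : ℝ) + 1) ^ 2 * (σ * Real.exp 2) ≤ 1 / 2 := by nlinarith
  have hA8 : 2 * (σ * Real.exp 2) ≤ 1 / 8 := by nlinarith
  have hw : ∀ Z ∈ polys R X, 0 ≤ wt σ Z := fun Z _ => wt_nonneg hσ Z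
  have hanch := anchored_norm_le hR hΔ hnbr hσ hsmall' X
  have hQY : ∀ Z ∈ polys R X, ¬ Disjoint Z X := by
    intro Z hZ
    obtain ⟨hZX, hne, -⟩ := mem_polys.1 hZ
    exact fun hd => hne.ne_empty (subset_empty.1 fun x hx => (disjoint_left.1 hd hx (hZX hx)).elim)
  exact hstar_partialSum_le hw (fun _ _ => Nat.cast_nonneg _) (by positivity) (Nat.cast_nonneg _) hA8
    (vertexHyp_of_anchored hw hanch) (rootHyp_of_anchored hw hanch hQY) N

end Tuples

/-! ## §6 Assembly: the bound on `term`, `trunc`, the assignments, the `t`-integral -/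

section Assembly

variable {R : V → V → Prop} {nbr : V → Finset V} {Δ : ℕ} {nbar : ℕ} {Γ : Finset T} {loc : T → V}
  {g₃ : ℝ → (Fin (nbar + 1) → T) → Finset (Fin (nbar + 1)) → Finset V → ℝ} {θ β' : ℝ} {G : ℕ}

/-- Steps (a)–(c) on one term: for `t ∈ [0,1]` and (5.14.4),
`|term n| ≤ θ^{(1−β′)(n̄+1)} θ^{(β′/2)|X|} (n̄+1)! · (1/(n+1)!) Σ_{Z ∈ polys(X)^{n+1}} |ρ^T(Z)| Π_i w(Z_i)` with `w(Z) =
θ^{(β′/2)|Z|}e^{|Z|}`. [cite: BalabanImbrieJaffe1988, p.310 (Sect. 5.14)] -/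
theorem abs_term_le (hθ0 : 0 < θ) (hθ1 : θ ≤ 1) (hβ : 0 ≤ β')
    (h5144 : ∀ t ∈ Set.Icc (0 : ℝ) 1, ∀ (γ : Fin (nbar + 1) → T) (K : Finset (Fin (nbar + 1))) (Y : Finset V),
      (∀ j ∈ K, loc (γ j) ∈ Y) → |g₃ t γ K Y| ≤ θ ^ ((K.card : ℝ) + β' * ((Y \ K.image fun j => loc (γ j)).card : ℝ)))
    {t : ℝ} (ht : t ∈ Set.Icc (0 : ℝ) 1) (γ : Fin (nbar + 1) → T) (X : Finset V) (n : ℕ) :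
    |term R nbar loc g₃ t γ X n| ≤
      θ ^ ((1 - β') * (nbar + 1)) * θ ^ (β' / 2 * X.card) * (nbar + 1).factorial *
        ((1 / ((n + 1).factorial : ℝ)) * ∑ Z ∈ Fintype.piFinset (fun _ : Fin (n + 1) => polys R X),
          |(rhoT Z univ : ℝ)| * ∏ i, wt (θ ^ (β' / 2)) (Z i)) := by
  classical
  set C : ℝ := θ ^ ((1 - β') * (nbar + 1)) * θ ^ (β' / 2 * X.card) with hC
  have hC0 : 0 ≤ C := mul_nonneg (Real.rpow_nonneg hθ0.le _) (Real.rpow_nonneg hθ0.le _)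
  have hσ : 0 ≤ θ ^ (β' / 2) := Real.rpow_nonneg hθ0.le _
  -- the bound for one admissible (Z, f)
  have hZf : ∀ Z ∈ Fintype.piFinset (fun _ : Fin (n + 1) => polys R X), ∀ f : Fin (nbar + 1) → Fin (n + 1),
      |(if Adm nbar loc γ X Z f then (rhoT Z univ : ℝ) * ∏ i, g₃ t γ (fiber nbar f i) (Z i) else 0)| ≤
        (if ∀ j, loc (γ j) ∈ Z (f j) then 1 else 0) *
          (C * (|(rhoT Z univ : ℝ)| * ∏ i, (θ ^ (β' / 2)) ^ (Z i).card)) := by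
    intro Z hZ f
    by_cases hA : Adm nbar loc γ X Z f
    · rw [if_pos hA, if_pos hA.2, one_mul, abs_mul, abs_prod]
      have hprod : ∏ i, |g₃ t γ (fiber nbar f i) (Z i)| ≤
          θ ^ ((1 - β') * (nbar + 1)) * θ ^ (β' * ∑ i, ((Z i).card : ℝ)) :=
        prod_abs_g3_le hθ0 hθ1 hβ fun i => h5144 t ht γ _ _ fun j hj => by
          have := (mem_filter.1 hj).2
          rw [← this]; exact hA.2 j
      have hfill := rpow_fill_le hθ0 hθ1 hβ (β' := β') hA.1
      have hpow : ∏ i, θ ^ (β' / 2 * ((Z i).card : ℝ)) = ∏ i, (θ ^ (β' / 2)) ^ (Z i).card :=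
        prod_congr rfl fun i _ => by rw [Real.rpow_mul hθ0.le, Real.rpow_natCast]
      calc |(rhoT Z univ : ℝ)| * ∏ i, |g₃ t γ (fiber nbar f i) (Z i)|
          ≤ |(rhoT Z univ : ℝ)| * (θ ^ ((1 - β') * (nbar + 1)) *
              (θ ^ (β' / 2 * X.card) * ∏ i, θ ^ (β' / 2 * ((Z i).card : ℝ)))) :=
            mul_le_mul_of_nonneg_left (hprod.trans (mul_le_mul_of_nonneg_left hfill (Real.rpow_nonneg hθ0.le _)))
              (abs_nonneg _)
        _ = C * (|(rhoT Z univ : ℝ)| * ∏ i, (θ ^ (β' / 2)) ^ (Z i).card) := by rw [hpow, hC]; ring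
    · rw [if_neg hA, abs_zero]
      exact mul_nonneg (by split_ifs <;> norm_num) (mul_nonneg hC0 (mul_nonneg (abs_nonneg _)
        (prod_nonneg fun i _ => pow_nonneg hσ _)))
  -- sum over f: the multiplicity
  have hZ : ∀ Z ∈ Fintype.piFinset (fun _ : Fin (n + 1) => polys R X),
      |∑ f : Fin (nbar + 1) → Fin (n + 1),
          (if Adm nbar loc γ X Z f then (rhoT Z univ : ℝ) * ∏ i, g₃ t γ (fiber nbar f i) (Z i) else 0)| ≤
        C * (nbar + 1).factorial * (|(rhoT Z univ : ℝ)| * ∏ i, wt (θ ^ (β' / 2)) (Z i)) := by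
    intro Z hZ
    have hmult := card_labellings_le (loc := loc) γ Z
    have hB0 : 0 ≤ C * (|(rhoT Z univ : ℝ)| * ∏ i, (θ ^ (β' / 2)) ^ (Z i).card) :=
      mul_nonneg hC0 (mul_nonneg (abs_nonneg _) (prod_nonneg fun i _ => pow_nonneg hσ _))
    calc |∑ f : Fin (nbar + 1) → Fin (n + 1),
            (if Adm nbar loc γ X Z f then (rhoT Z univ : ℝ) * ∏ i, g₃ t γ (fiber nbar f i) (Z i) else 0)|
        ≤ ∑ f : Fin (nbar + 1) → Fin (n + 1),
            |(if Adm nbar loc γ X Z f then (rhoT Z univ : ℝ) * ∏ i, g₃ t γ (fiber nbar f i) (Z i) else 0)| :=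
          abs_sum_le_sum_abs _ _
      _ ≤ ∑ f : Fin (nbar + 1) → Fin (n + 1), (if ∀ j, loc (γ j) ∈ Z (f j) then 1 else 0) *
            (C * (|(rhoT Z univ : ℝ)| * ∏ i, (θ ^ (β' / 2)) ^ (Z i).card)) := sum_le_sum fun f _ => hZf Z hZ f
      _ = (((univ : Finset (Fin (nbar + 1) → Fin (n + 1))).filter fun f => ∀ j, loc (γ j) ∈ Z (f j)).card : ℝ) *
            (C * (|(rhoT Z univ : ℝ)| * ∏ i, (θ ^ (β' / 2)) ^ (Z i).card)) := by
          rw [← sum_mul, ← sum_filter, sum_const, nsmul_eq_mul, mul_one]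
      _ ≤ ((nbar + 1).factorial * Real.exp (∑ i, ((Z i).card : ℝ))) *
            (C * (|(rhoT Z univ : ℝ)| * ∏ i, (θ ^ (β' / 2)) ^ (Z i).card)) :=
          mul_le_mul_of_nonneg_right hmult hB0
      _ = C * (nbar + 1).factorial * (|(rhoT Z univ : ℝ)| * ∏ i, wt (θ ^ (β' / 2)) (Z i)) := by
          simp only [wt]
          rw [prod_mul_distrib, ← Real.exp_sum]
          ring
  -- sum over Z and the factor 1/(n+1)!
  have hfac : 0 ≤ (1 / ((n + 1).factorial : ℝ)) := by positivity
  unfold term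
  rw [abs_mul, abs_of_nonneg hfac]
  calc (1 / ((n + 1).factorial : ℝ)) * |∑ Z ∈ Fintype.piFinset (fun _ : Fin (n + 1) => polys R X),
          ∑ f : Fin (nbar + 1) → Fin (n + 1),
            (if Adm nbar loc γ X Z f then (rhoT Z univ : ℝ) * ∏ i, g₃ t γ (fiber nbar f i) (Z i) else 0)|
      ≤ (1 / ((n + 1).factorial : ℝ)) * ∑ Z ∈ Fintype.piFinset (fun _ : Fin (n + 1) => polys R X),
          C * (nbar + 1).factorial * (|(rhoT Z univ : ℝ)| * ∏ i, wt (θ ^ (β' / 2)) (Z i)) :=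
        mul_le_mul_of_nonneg_left ((abs_sum_le_sum_abs _ _).trans (sum_le_sum hZ)) hfac
    _ = _ := by rw [← mul_sum, hC]; ring

/-- Steps (a)–(d): the partial sums of `Σ_n |term n|` are bounded by
`M(X) = θ^{(1−β′)(n̄+1)} θ^{(β′/2)|X|} (n̄+1)! · 4θ^{β′/2}e²|X|`. [cite: BalabanImbrieJaffe1988, p.310 (Sect. 5.14)] -/
theorem sum_abs_term_le (hR : ∀ x y, R x y → R y x) (hΔ : ∀ x, (nbr x).card ≤ Δ) (hnbr : ∀ x y, R x y → y ∈ nbr x)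
    (hθ0 : 0 < θ) (hθ1 : θ ≤ 1) (hβ : 0 ≤ β')
    (hsmall : 16 * ((Δ : ℝ) + 1) ^ 2 * (θ ^ (β' / 2) * Real.exp 2) ≤ 1)
    (h5144 : ∀ t ∈ Set.Icc (0 : ℝ) 1, ∀ (γ : Fin (nbar + 1) → T) (K : Finset (Fin (nbar + 1))) (Y : Finset V),
      (∀ j ∈ K, loc (γ j) ∈ Y) → |g₃ t γ K Y| ≤ θ ^ ((K.card : ℝ) + β' * ((Y \ K.image fun j => loc (γ j)).card : ℝ)))
    {t : ℝ} (ht : t ∈ Set.Icc (0 : ℝ) 1) (γ : Fin (nbar + 1) → T) (X : Finset V) (N : ℕ) :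
    ∑ n ∈ range N, |term R nbar loc g₃ t γ X n| ≤
      θ ^ ((1 - β') * (nbar + 1)) * θ ^ (β' / 2 * X.card) * (nbar + 1).factorial *
        (2 * (2 * (θ ^ (β' / 2) * Real.exp 2)) * X.card) := by
  have hC0 : 0 ≤ θ ^ ((1 - β') * (nbar + 1)) * θ ^ (β' / 2 * X.card) * (nbar + 1).factorial :=
    mul_nonneg (mul_nonneg (Real.rpow_nonneg hθ0.le _) (Real.rpow_nonneg hθ0.le _)) (Nat.cast_nonneg _)
  calc ∑ n ∈ range N, |term R nbar loc g₃ t γ X n|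
      ≤ ∑ n ∈ range N, θ ^ ((1 - β') * (nbar + 1)) * θ ^ (β' / 2 * X.card) * (nbar + 1).factorial *
          ((1 / ((n + 1).factorial : ℝ)) * ∑ Z ∈ Fintype.piFinset (fun _ : Fin (n + 1) => polys R X),
            |(rhoT Z univ : ℝ)| * ∏ i, wt (θ ^ (β' / 2)) (Z i)) :=
        sum_le_sum fun n _ => abs_term_le hθ0 hθ1 hβ h5144 ht γ X n
    _ = θ ^ ((1 - β') * (nbar + 1)) * θ ^ (β' / 2 * X.card) * (nbar + 1).factorial *
          ∑ n ∈ range N, ((1 / ((n + 1).factorial : ℝ)) *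
            ∑ Z ∈ Fintype.piFinset (fun _ : Fin (n + 1) => polys R X),
              |(rhoT Z univ : ℝ)| * ∏ i, wt (θ ^ (β' / 2)) (Z i)) := by rw [mul_sum]
    _ ≤ _ := mul_le_mul_of_nonneg_left
        (partialSum_le hR hΔ hnbr (Real.rpow_nonneg hθ0.le _) hsmall X N) hC0

/-- Absolute convergence of the cluster series `trunc = Σ'_n term n` (the expansion converges).
[cite: BalabanImbrieJaffe1988, p.310 (Sect. 5.14)] -/
theorem summable_abs_term (hR : ∀ x y, R x y → R y x) (hΔ : ∀ x, (nbr x).card ≤ Δ) (hnbr : ∀ x y, R x y → y ∈ nbr x)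
    (hθ0 : 0 < θ) (hθ1 : θ ≤ 1) (hβ : 0 ≤ β')
    (hsmall : 16 * ((Δ : ℝ) + 1) ^ 2 * (θ ^ (β' / 2) * Real.exp 2) ≤ 1)
    (h5144 : ∀ t ∈ Set.Icc (0 : ℝ) 1, ∀ (γ : Fin (nbar + 1) → T) (K : Finset (Fin (nbar + 1))) (Y : Finset V),
      (∀ j ∈ K, loc (γ j) ∈ Y) → |g₃ t γ K Y| ≤ θ ^ ((K.card : ℝ) + β' * ((Y \ K.image fun j => loc (γ j)).card : ℝ)))
    {t : ℝ} (ht : t ∈ Set.Icc (0 : ℝ) 1) (γ : Fin (nbar + 1) → T) (X : Finset V) :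
    Summable fun n => |term R nbar loc g₃ t γ X n| :=
  summable_of_sum_range_le (fun _ => abs_nonneg _) (sum_abs_term_le hR hΔ hnbr hθ0 hθ1 hβ hsmall h5144 ht γ X)

/-- Steps (a)–(d): `|trunc t γ X| ≤ M(X)`. [cite: BalabanImbrieJaffe1988, p.310 (Sect. 5.14)] -/
theorem abs_trunc_le (hR : ∀ x y, R x y → R y x) (hΔ : ∀ x, (nbr x).card ≤ Δ) (hnbr : ∀ x y, R x y → y ∈ nbr x)
    (hθ0 : 0 < θ) (hθ1 : θ ≤ 1) (hβ : 0 ≤ β')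
    (hsmall : 16 * ((Δ : ℝ) + 1) ^ 2 * (θ ^ (β' / 2) * Real.exp 2) ≤ 1)
    (h5144 : ∀ t ∈ Set.Icc (0 : ℝ) 1, ∀ (γ : Fin (nbar + 1) → T) (K : Finset (Fin (nbar + 1))) (Y : Finset V),
      (∀ j ∈ K, loc (γ j) ∈ Y) → |g₃ t γ K Y| ≤ θ ^ ((K.card : ℝ) + β' * ((Y \ K.image fun j => loc (γ j)).card : ℝ)))
    {t : ℝ} (ht : t ∈ Set.Icc (0 : ℝ) 1) (γ : Fin (nbar + 1) → T) (X : Finset V) :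
    |trunc R nbar loc g₃ t γ X| ≤
      θ ^ ((1 - β') * (nbar + 1)) * θ ^ (β' / 2 * X.card) * (nbar + 1).factorial *
        (2 * (2 * (θ ^ (β' / 2) * Real.exp 2)) * X.card) := by
  have hs := summable_abs_term hR hΔ hnbr hθ0 hθ1 hβ hsmall h5144 ht γ X
  have hs' : Summable fun n => ‖term R nbar loc g₃ t γ X n‖ := by simpa only [Real.norm_eq_abs] using hs
  have h1 := norm_tsum_le_tsum_norm hs'
  simp only [Real.norm_eq_abs] at h1
  unfold trunc
  exact h1.trans (Real.tsum_le_of_sum_range_le (fun _ => abs_nonneg _)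
    (sum_abs_term_le hR hΔ hnbr hθ0 hθ1 hβ hsmall h5144 ht γ X))

/-- Step (e): the assignments `{γ_j}` localized in `X` number at most `(G|X|)^{n̄+1}` when every cube carries at most `G` targets.
[cite: BalabanImbrieJaffe1988, p.310 (Sect. 5.14)] -/
theorem card_assignments_le (hG : ∀ q, (Γ.filter fun τ => loc τ = q).card ≤ G) (X : Finset V) :
    ((assignments nbar Γ loc X).card : ℝ) ≤ ((G : ℝ) * X.card) ^ (nbar + 1) := by
  have h1 : (Γ.filter fun τ => loc τ ∈ X).card ≤ G * X.card := by
    rw [card_eq_sum_card_fiberwise (f := loc) (s := Γ.filter fun τ => loc τ ∈ X) (t := X)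
      (fun τ hτ => by exact (mem_filter.1 (mem_coe.1 hτ)).2)]
    calc ∑ q ∈ X, ((Γ.filter fun τ => loc τ ∈ X).filter fun τ => loc τ = q).card
        ≤ ∑ q ∈ X, (Γ.filter fun τ => loc τ = q).card :=
          sum_le_sum fun q _ => card_le_card fun τ hτ => by
            simp only [mem_filter] at hτ ⊢
            exact ⟨hτ.1.1, hτ.2⟩
      _ ≤ ∑ _q ∈ X, G := sum_le_sum fun q _ => hG q
      _ = G * X.card := by rw [sum_const, smul_eq_mul, mul_comm]
  unfold assignments
  rw [Fintype.card_piFinset_const, Nat.cast_pow]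
  exact pow_le_pow_left₀ (Nat.cast_nonneg _) (by exact_mod_cast h1) _

/-- **THE W₆′ BOUND, quantitative form** (steps (a)–(f)): for `R` symmetric of degree `≤ Δ`, at most `G` targets per cube,
`0 < θ ≤ 1`, `β′ ≥ 0`, the smallness `16(Δ+1)²e²θ^{β′/2} ≤ 1` and the activity bounds (5.14.4) on `[0,1]`:
`|W₆′(X)| ≤ 4e²θ^{β′/2} · (G|X|)^{n̄+1}|X| · θ^{(1−β′)(n̄+1)} · θ^{(β′/2)|X|}`. [cite: BalabanImbrieJaffe1988, p.310 (Sect. 5.14)] -/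
theorem abs_W6'_le (hR : ∀ x y, R x y → R y x) (hΔ : ∀ x, (nbr x).card ≤ Δ) (hnbr : ∀ x y, R x y → y ∈ nbr x)
    (hG : ∀ q, (Γ.filter fun τ => loc τ = q).card ≤ G) (hθ0 : 0 < θ) (hθ1 : θ ≤ 1) (hβ : 0 ≤ β')
    (hsmall : 16 * ((Δ : ℝ) + 1) ^ 2 * (θ ^ (β' / 2) * Real.exp 2) ≤ 1)
    (h5144 : ∀ t ∈ Set.Icc (0 : ℝ) 1, ∀ (γ : Fin (nbar + 1) → T) (K : Finset (Fin (nbar + 1))) (Y : Finset V),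
      (∀ j ∈ K, loc (γ j) ∈ Y) → |g₃ t γ K Y| ≤ θ ^ ((K.card : ℝ) + β' * ((Y \ K.image fun j => loc (γ j)).card : ℝ)))
    (X : Finset V) :
    |W6' R nbar Γ loc g₃ X| ≤
      4 * Real.exp 2 * θ ^ (β' / 2) * (((G : ℝ) * X.card) ^ (nbar + 1) * X.card) *
        (θ ^ ((1 - β') * (nbar + 1)) * θ ^ (β' / 2 * X.card)) := by
  set M : ℝ := θ ^ ((1 - β') * (nbar + 1)) * θ ^ (β' / 2 * X.card) * (nbar + 1).factorial *
    (2 * (2 * (θ ^ (β' / 2) * Real.exp 2)) * X.card) with hM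
  have hM0 : 0 ≤ M := by positivity
  -- the integrand is bounded on (0, 1]
  have hbound : ∀ t ∈ Set.uIoc (0 : ℝ) 1,
      ‖(-((1 - t) ^ nbar / ((nbar + 1).factorial : ℝ))) * ∑ γ ∈ assignments nbar Γ loc X, trunc R nbar loc g₃ t γ X‖ ≤
        (1 / ((nbar + 1).factorial : ℝ)) * (((G : ℝ) * X.card) ^ (nbar + 1) * M) := by
    intro t ht
    rw [Set.uIoc_of_le zero_le_one] at ht
    have ht' : t ∈ Set.Icc (0 : ℝ) 1 := ⟨ht.1.le, ht.2⟩
    rw [Real.norm_eq_abs, abs_mul, abs_neg, abs_div, abs_of_nonneg (pow_nonneg (by linarith [ht.2]) _),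
      Nat.abs_cast]
    have hpow : (1 - t) ^ nbar / ((nbar + 1).factorial : ℝ) ≤ 1 / ((nbar + 1).factorial : ℝ) :=
      div_le_div_of_nonneg_right (pow_le_one₀ (by linarith [ht.2]) (by linarith [ht.1])) (by positivity)
    have hsum : |∑ γ ∈ assignments nbar Γ loc X, trunc R nbar loc g₃ t γ X| ≤ ((G : ℝ) * X.card) ^ (nbar + 1) * M :=
      calc |∑ γ ∈ assignments nbar Γ loc X, trunc R nbar loc g₃ t γ X|
          ≤ ∑ γ ∈ assignments nbar Γ loc X, |trunc R nbar loc g₃ t γ X| := abs_sum_le_sum_abs _ _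
        _ ≤ ∑ _γ ∈ assignments nbar Γ loc X, M :=
            sum_le_sum fun γ _ => abs_trunc_le hR hΔ hnbr hθ0 hθ1 hβ hsmall h5144 ht' γ X
        _ = (assignments nbar Γ loc X).card * M := by rw [sum_const, nsmul_eq_mul]
        _ ≤ ((G : ℝ) * X.card) ^ (nbar + 1) * M := mul_le_mul_of_nonneg_right (card_assignments_le hG X) hM0
    exact mul_le_mul hpow hsum (abs_nonneg _) (by positivity)
  have hint := intervalIntegral.norm_integral_le_of_norm_le_const hbound
  rw [sub_zero, abs_one, mul_one, Real.norm_eq_abs] at hint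
  refine hint.trans (le_of_eq ?_)
  rw [hM]
  field_simp
  ring

end Assembly

/-! ## §7 The printed shape: `|W₆′(X)| ≤ θ^{(1−β′)(n̄+1)+(β′/4)|X|}`, r16's leaf `IneqW6'` with the adjusted constants -/

section Printed

variable {R : V → V → Prop} {nbr : V → Finset V} {Δ : ℕ} {nbar : ℕ} {Γ : Finset T} {loc : T → V}
  {g₃ : ℝ → (Fin (nbar + 1) → T) → Finset (Fin (nbar + 1)) → Finset V → ℝ} {θ β' : ℝ} {G : ℕ}

/-- The absorption of a polynomial prefactor into a fraction of the exponential decay: `x^m e^{−cx} ≤ m!/c^m` gives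
`K x^m θ^{a x} ≤ 1` for `x ≥ 0` once `K·m! ≤ (a log θ⁻¹)^m` (`0 < θ ≤ 1`, `K, a ≥ 0`). [cite: BalabanImbrieJaffe1988, p.310 (Sect. 5.14)] -/
theorem mul_pow_mul_rpow_le_one (hθ0 : 0 < θ) (hθ1 : θ ≤ 1) {K a x : ℝ} (hK : 0 ≤ K) (ha : 0 ≤ a) (hx : 0 ≤ x) {m : ℕ}
    (habs : K * m.factorial ≤ (a * Real.log θ⁻¹) ^ m) : K * x ^ m * θ ^ (a * x) ≤ 1 := by
  set c : ℝ := a * Real.log θ⁻¹ with hc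
  have hc0 : 0 ≤ c := mul_nonneg ha (Real.log_nonneg ((one_le_inv₀ hθ0).2 hθ1))
  have hθc : θ ^ (a * x) = Real.exp (-(c * x)) := by
    rw [Real.rpow_def_of_pos hθ0, hc, Real.log_inv]
    congr 1
    ring
  rw [hθc]
  rcases hc0.eq_or_lt with hc00 | hcpos
  · -- `c = 0`
    rw [← hc00] at habs
    rw [← hc00, zero_mul, neg_zero, Real.exp_zero, mul_one]
    rcases m.eq_zero_or_pos with hm | hm
    · subst hm
      simpa using habs
    · have h0 : K * m.factorial ≤ 0 := by simpa [zero_pow hm.ne'] using habs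
      have hKm : K * m.factorial = 0 := le_antisymm h0 (by positivity)
      rcases mul_eq_zero.1 hKm with h | h
      · rw [h, zero_mul]; exact zero_le_one
      · exact absurd h (Nat.cast_ne_zero.2 (Nat.factorial_ne_zero m))
  · -- `c > 0`
    have h1 := pow_mul_exp_neg_le hx hcpos m
    calc K * x ^ m * Real.exp (-(c * x)) = K * (x ^ m * Real.exp (-(c * x))) := by ring
      _ ≤ K * (m.factorial / c ^ m) := mul_le_mul_of_nonneg_left h1 hK
      _ = K * m.factorial / c ^ m := by ring
      _ ≤ 1 := div_le_one_of_le₀ habs (pow_nonneg hc0 _)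

/-- **THE W₆′ BOUND IN THE PRINTED SHAPE**: under the hypotheses of `abs_W6'_le` and the absorption condition
`4e²θ^{β′/2}G^{n̄+1}(n̄+2)! ≤ ((β′/4) log θ⁻¹)^{n̄+2}`,  `|W₆^{(k)′}(X)| ≤ θ^{(1−β′)(n̄+1) + (β′/4)|X|}` — the printed
`θ^{n̄+1+β′|X|}` after the printed *"adjustments in β, α, β′"* (READING (iii)). [cite: BalabanImbrieJaffe1988, p.310 (Sect. 5.14)] -/
theorem abs_W6'_le_rpow (hR : ∀ x y, R x y → R y x) (hΔ : ∀ x, (nbr x).card ≤ Δ) (hnbr : ∀ x y, R x y → y ∈ nbr x)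
    (hG : ∀ q, (Γ.filter fun τ => loc τ = q).card ≤ G) (hθ0 : 0 < θ) (hθ1 : θ ≤ 1) (hβ : 0 ≤ β')
    (hsmall : 16 * ((Δ : ℝ) + 1) ^ 2 * (θ ^ (β' / 2) * Real.exp 2) ≤ 1)
    (habs : 4 * Real.exp 2 * θ ^ (β' / 2) * (G : ℝ) ^ (nbar + 1) * (nbar + 2).factorial ≤
      (β' / 4 * Real.log θ⁻¹) ^ (nbar + 2))
    (h5144 : ∀ t ∈ Set.Icc (0 : ℝ) 1, ∀ (γ : Fin (nbar + 1) → T) (K : Finset (Fin (nbar + 1))) (Y : Finset V),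
      (∀ j ∈ K, loc (γ j) ∈ Y) → |g₃ t γ K Y| ≤ θ ^ ((K.card : ℝ) + β' * ((Y \ K.image fun j => loc (γ j)).card : ℝ)))
    (X : Finset V) :
    |W6' R nbar Γ loc g₃ X| ≤ θ ^ ((1 - β') * (nbar + 1) + β' / 4 * X.card) := by
  have h := abs_W6'_le hR hΔ hnbr hG hθ0 hθ1 hβ hsmall h5144 X
  set K : ℝ := 4 * Real.exp 2 * θ ^ (β' / 2) * (G : ℝ) ^ (nbar + 1) with hK
  have hK0 : 0 ≤ K := by positivity
  have habs' : K * (nbar + 2).factorial ≤ (β' / 4 * Real.log θ⁻¹) ^ (nbar + 2) := by rw [hK]; exact habs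
  have hab := mul_pow_mul_rpow_le_one hθ0 hθ1 hK0 (by positivity : (0 : ℝ) ≤ β' / 4) (Nat.cast_nonneg X.card)
    (m := nbar + 2) habs'
  have hsplit : θ ^ (β' / 2 * (X.card : ℝ)) = θ ^ (β' / 4 * (X.card : ℝ)) * θ ^ (β' / 4 * (X.card : ℝ)) := by
    rw [← Real.rpow_add hθ0]; congr 1; ring
  have hgoal : θ ^ ((1 - β') * (nbar + 1) + β' / 4 * X.card) =
      θ ^ ((1 - β') * (nbar + 1)) * θ ^ (β' / 4 * (X.card : ℝ)) := Real.rpow_add hθ0 _ _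
  have hpos : 0 ≤ θ ^ ((1 - β') * (nbar + 1)) * θ ^ (β' / 4 * (X.card : ℝ)) :=
    mul_nonneg (Real.rpow_nonneg hθ0.le _) (Real.rpow_nonneg hθ0.le _)
  calc |W6' R nbar Γ loc g₃ X|
      ≤ 4 * Real.exp 2 * θ ^ (β' / 2) * (((G : ℝ) * X.card) ^ (nbar + 1) * X.card) *
          (θ ^ ((1 - β') * (nbar + 1)) * θ ^ (β' / 2 * X.card)) := h
    _ = (θ ^ ((1 - β') * (nbar + 1)) * θ ^ (β' / 4 * (X.card : ℝ))) *
          (K * (X.card : ℝ) ^ (nbar + 2) * θ ^ (β' / 4 * (X.card : ℝ))) := by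
        rw [hsplit, hK]; ring
    _ ≤ (θ ^ ((1 - β') * (nbar + 1)) * θ ^ (β' / 4 * (X.card : ℝ))) * 1 := mul_le_mul_of_nonneg_left hab hpos
    _ = θ ^ ((1 - β') * (nbar + 1) + β' / 4 * X.card) := by rw [mul_one, hgoal]

/-- **r16's TYPED LEAF `IneqW6'` FOR THE MODEL** (row C2.Claim@310, p. 310): under the hypotheses of `abs_W6'_le_rpow` and
`β′ < 1`, `IneqW6' (cubeSys V) W₆′ (θ^{1−β′}) (β′/(4(1−β′))) n̄` — verbatim the printed `|W₆^{(k)′}(X)| ≤ ϑ^{n̄+1+β″|X|}` with the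
adjusted vertex factor `ϑ = θ^{1−β′}` (α-adjustment) and `β″ = β′/(4(1−β′))` (β′-adjustment). [cite: BalabanImbrieJaffe1988, p.310 (Sect. 5.14)] -/
theorem ineqW6'_holds (hR : ∀ x y, R x y → R y x) (hΔ : ∀ x, (nbr x).card ≤ Δ) (hnbr : ∀ x y, R x y → y ∈ nbr x)
    (hG : ∀ q, (Γ.filter fun τ => loc τ = q).card ≤ G) (hθ0 : 0 < θ) (hθ1 : θ ≤ 1) (hβ : 0 ≤ β') (hβ1 : β' < 1)
    (hsmall : 16 * ((Δ : ℝ) + 1) ^ 2 * (θ ^ (β' / 2) * Real.exp 2) ≤ 1)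
    (habs : 4 * Real.exp 2 * θ ^ (β' / 2) * (G : ℝ) ^ (nbar + 1) * (nbar + 2).factorial ≤
      (β' / 4 * Real.log θ⁻¹) ^ (nbar + 2))
    (h5144 : ∀ t ∈ Set.Icc (0 : ℝ) 1, ∀ (γ : Fin (nbar + 1) → T) (K : Finset (Fin (nbar + 1))) (Y : Finset V),
      (∀ j ∈ K, loc (γ j) ∈ Y) → |g₃ t γ K Y| ≤ θ ^ ((K.card : ℝ) + β' * ((Y \ K.image fun j => loc (γ j)).card : ℝ))) :
    BIJ88Sect5StatementsPart2.IneqW6' (cubeSys V) (W6' R nbar Γ loc g₃) (θ ^ (1 - β')) (β' / (4 * (1 - β'))) nbar := by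
  intro X
  have h := abs_W6'_le_rpow hR hΔ hnbr hG hθ0 hθ1 hβ hsmall habs h5144 X
  have hb : (1 : ℝ) - β' ≠ 0 := by linarith
  have hexp : (θ ^ (1 - β')) ^ ((nbar : ℝ) + 1 + β' / (4 * (1 - β')) * ((cubeSys V).card X : ℝ)) =
      θ ^ ((1 - β') * (nbar + 1) + β' / 4 * X.card) := by
    rw [← Real.rpow_mul hθ0.le, cubeSys_card]
    congr 1
    field_simp
  rw [hexp]
  exact h

/-- The activity input in the letters of r16's typed (5.14.4) leaf: `Ineq5144 (cubeSys V) Lab g₃ (|·|) (|· ∖ loc ·|) θ β′` with the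
labels `Lab = (t, γ, K)` implies the support-conditioned bound on `[0,1]` used above. [cite: BalabanImbrieJaffe1988, (5.14.4) p.309] -/
theorem hyp_of_ineq5144
    (h : BIJ88Sect5StatementsPart2.Ineq5144 (cubeSys V) (ℝ × (Fin (nbar + 1) → T) × Finset (Fin (nbar + 1)))
      (fun ℓ Y => g₃ ℓ.1 ℓ.2.1 ℓ.2.2 Y) (fun ℓ => ℓ.2.2.card)
      (fun ℓ (Y : Finset V) => (Y \ ℓ.2.2.image fun j => loc (ℓ.2.1 j)).card) θ β') :
    ∀ t ∈ Set.Icc (0 : ℝ) 1, ∀ (γ : Fin (nbar + 1) → T) (K : Finset (Fin (nbar + 1))) (Y : Finset V),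
      (∀ j ∈ K, loc (γ j) ∈ Y) → |g₃ t γ K Y| ≤ θ ^ ((K.card : ℝ) + β' * ((Y \ K.image fun j => loc (γ j)).card : ℝ)) :=
  fun t _ γ K Y _ => h (t, γ, K) Y

/-- **FROM r16's (5.14.4) LEAF TO r16's W₆′ LEAF** for the model: `Ineq5144 ⟹ IneqW6'` with the adjusted constants, under the
geometric hypotheses and the two smallness conditions on the vertex factor. [cite: BalabanImbrieJaffe1988, p.310 (Sect. 5.14)] -/
theorem ineqW6'_of_ineq5144 (hR : ∀ x y, R x y → R y x) (hΔ : ∀ x, (nbr x).card ≤ Δ) (hnbr : ∀ x y, R x y → y ∈ nbr x)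
    (hG : ∀ q, (Γ.filter fun τ => loc τ = q).card ≤ G) (hθ0 : 0 < θ) (hθ1 : θ ≤ 1) (hβ : 0 ≤ β') (hβ1 : β' < 1)
    (hsmall : 16 * ((Δ : ℝ) + 1) ^ 2 * (θ ^ (β' / 2) * Real.exp 2) ≤ 1)
    (habs : 4 * Real.exp 2 * θ ^ (β' / 2) * (G : ℝ) ^ (nbar + 1) * (nbar + 2).factorial ≤
      (β' / 4 * Real.log θ⁻¹) ^ (nbar + 2))
    (h : BIJ88Sect5StatementsPart2.Ineq5144 (cubeSys V) (ℝ × (Fin (nbar + 1) → T) × Finset (Fin (nbar + 1)))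
      (fun ℓ Y => g₃ ℓ.1 ℓ.2.1 ℓ.2.2 Y) (fun ℓ => ℓ.2.2.card)
      (fun ℓ (Y : Finset V) => (Y \ ℓ.2.2.image fun j => loc (ℓ.2.1 j)).card) θ β') :
    BIJ88Sect5StatementsPart2.IneqW6' (cubeSys V) (W6' R nbar Γ loc g₃) (θ ^ (1 - β')) (β' / (4 * (1 - β'))) nbar :=
  ineqW6'_holds hR hΔ hnbr hG hθ0 hθ1 hβ hβ1 hsmall habs (hyp_of_ineq5144 h)

/-- **THE THRESHOLD θ₀(Δ, G, n̄, β′)**: for `0 < β′`, both smallness conditions hold for every vertex factor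
`0 < θ ≤ θ₀ := min{e^{−4/β′}, A^{−2/β′}, B^{−2/β′}}`, `A = 16(Δ+1)²e²`, `B = max{1, 4e²G^{n̄+1}(n̄+2)!}` — *"(We allow adjustments in β, α,
β′, keeping them small.)"*: the vertex factor `e^β(L^kε/ε₀)^{1/4−α} → 0` as `L^kε/ε₀ → 0`. [cite: BalabanImbrieJaffe1988, p.310 (Sect. 5.14)] -/
theorem exists_theta0 (Δ G nbar : ℕ) {β' : ℝ} (hβ0 : 0 < β') :
    ∃ θ₀ : ℝ, 0 < θ₀ ∧ ∀ θ : ℝ, 0 < θ → θ ≤ θ₀ →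
      16 * ((Δ : ℝ) + 1) ^ 2 * (θ ^ (β' / 2) * Real.exp 2) ≤ 1 ∧
      4 * Real.exp 2 * θ ^ (β' / 2) * (G : ℝ) ^ (nbar + 1) * (nbar + 2).factorial ≤
        (β' / 4 * Real.log θ⁻¹) ^ (nbar + 2) := by
  set A : ℝ := 16 * ((Δ : ℝ) + 1) ^ 2 * Real.exp 2 with hA
  set B : ℝ := max 1 (4 * Real.exp 2 * (G : ℝ) ^ (nbar + 1) * (nbar + 2).factorial) with hB
  have hA0 : 0 < A := by positivity
  have hB1 : 1 ≤ B := le_max_left _ _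
  have hB0 : 0 < B := lt_of_lt_of_le one_pos hB1
  refine ⟨min (Real.exp (-4 / β')) (min (A ^ (-2 / β')) (B ^ (-2 / β'))), by positivity, ?_⟩
  intro θ hθ0 hθle
  have h1 : θ ≤ Real.exp (-4 / β') := hθle.trans (min_le_left _ _)
  have h2 : θ ≤ A ^ (-2 / β') := hθle.trans ((min_le_right _ _).trans (min_le_left _ _))
  have h3 : θ ≤ B ^ (-2 / β') := hθle.trans ((min_le_right _ _).trans (min_le_right _ _))
  have hβ2 : 0 < β' / 2 := by positivity
  -- θ^{β′/2} ≤ A⁻¹ and ≤ B⁻¹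
  have hpowA : θ ^ (β' / 2) ≤ A⁻¹ := by
    calc θ ^ (β' / 2) ≤ (A ^ (-2 / β')) ^ (β' / 2) := Real.rpow_le_rpow hθ0.le h2 hβ2.le
      _ = A⁻¹ := by
          rw [← Real.rpow_mul hA0.le, show (-2 / β') * (β' / 2) = -1 by field_simp, Real.rpow_neg_one]
  have hpowB : θ ^ (β' / 2) ≤ B⁻¹ := by
    calc θ ^ (β' / 2) ≤ (B ^ (-2 / β')) ^ (β' / 2) := Real.rpow_le_rpow hθ0.le h3 hβ2.le
      _ = B⁻¹ := by
          rw [← Real.rpow_mul hB0.le, show (-2 / β') * (β' / 2) = -1 by field_simp, Real.rpow_neg_one]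
  constructor
  · calc 16 * ((Δ : ℝ) + 1) ^ 2 * (θ ^ (β' / 2) * Real.exp 2) = A * θ ^ (β' / 2) := by rw [hA]; ring
      _ ≤ A * A⁻¹ := mul_le_mul_of_nonneg_left hpowA hA0.le
      _ = 1 := mul_inv_cancel₀ hA0.ne'
  · -- the left side is ≤ B·B⁻¹ = 1, the right side is ≥ 1
    have hlog : 1 ≤ β' / 4 * Real.log θ⁻¹ := by
      rw [Real.log_inv]
      have : Real.log θ ≤ -4 / β' := by
        have := Real.log_le_log hθ0 h1
        rwa [Real.log_exp] at this
      have h4 : β' / 4 * (-4 / β') = -1 := by field_simp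
      nlinarith [mul_le_mul_of_nonneg_left this (by positivity : (0 : ℝ) ≤ β' / 4)]
    calc 4 * Real.exp 2 * θ ^ (β' / 2) * (G : ℝ) ^ (nbar + 1) * (nbar + 2).factorial
        = (4 * Real.exp 2 * (G : ℝ) ^ (nbar + 1) * (nbar + 2).factorial) * θ ^ (β' / 2) := by ring
      _ ≤ B * B⁻¹ := mul_le_mul (le_max_right _ _) hpowB (Real.rpow_nonneg hθ0.le _) hB0.le
      _ = 1 := mul_inv_cancel₀ hB0.ne'
      _ ≤ (β' / 4 * Real.log θ⁻¹) ^ (nbar + 2) := one_le_pow₀ hlog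

/-- **THE ROW, ASSEMBLED**: for every adjacency of degree `≤ Δ`, target multiplicity `≤ G`, `n̄`, and `0 < β′ < 1` there is an explicit
`θ₀ > 0` such that for EVERY vertex factor `0 < θ ≤ θ₀` and every model datum whose activities obey (5.14.4) (r16's leaf `Ineq5144`)
the W₆′ of p. 310 obeys r16's leaf `IneqW6'` with the adjusted constants `θ^{1−β′}`, `β′/(4(1−β′))`.
[cite: BalabanImbrieJaffe1988, p.310 (Sect. 5.14)] -/
theorem ineqW6'_eventually (hR : ∀ x y, R x y → R y x) (hΔ : ∀ x, (nbr x).card ≤ Δ) (hnbr : ∀ x y, R x y → y ∈ nbr x)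
    (hG : ∀ q, (Γ.filter fun τ => loc τ = q).card ≤ G) (hβ0 : 0 < β') (hβ1 : β' < 1) :
    ∃ θ₀ : ℝ, 0 < θ₀ ∧ ∀ θ : ℝ, 0 < θ → θ ≤ θ₀ →
      ∀ g₃ : ℝ → (Fin (nbar + 1) → T) → Finset (Fin (nbar + 1)) → Finset V → ℝ,
        BIJ88Sect5StatementsPart2.Ineq5144 (cubeSys V) (ℝ × (Fin (nbar + 1) → T) × Finset (Fin (nbar + 1)))
          (fun ℓ Y => g₃ ℓ.1 ℓ.2.1 ℓ.2.2 Y) (fun ℓ => ℓ.2.2.card)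
          (fun ℓ (Y : Finset V) => (Y \ ℓ.2.2.image fun j => loc (ℓ.2.1 j)).card) θ β' →
        BIJ88Sect5StatementsPart2.IneqW6' (cubeSys V) (W6' R nbar Γ loc g₃) (θ ^ (1 - β')) (β' / (4 * (1 - β'))) nbar := by
  obtain ⟨θ₀, hθ₀, hall⟩ := exists_theta0 Δ G nbar hβ0
  refine ⟨min θ₀ 1, by positivity, fun θ hθ0 hθle g₃ h => ?_⟩
  obtain ⟨hsmall, habs⟩ := hall θ hθ0 (hθle.trans (min_le_left _ _))
  exact ineqW6'_of_ineq5144 hR hΔ hnbr hG hθ0 (hθle.trans (min_le_right _ _)) hβ0.le hβ1 hsmall habs h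

end Printed


/-! ## §8 (v1.1, APPEND-ONLY — §§1–7 above are the accepted v1 text, unchanged) READING (iv) DISCHARGED

READING (iv) of the module docstring modelled the p. 310 display by the *ordered* form `term`
(`(1/(n+1)!) Σ_{(Z_0,…,Z_n)} Σ_{f : H → slots} [Adm] ρ^T(Z) Π_i g₃(f⁻¹ i, Z_i)`), asserting that it equals the printed
*partition* form `Σ_{{H_γ}∈𝒫(H)} Σ_{{X_γ}} Σ_{(Y₁,…,Y_B)} (1/B!) ρ^T Π_γ g₃(H_γ,X_γ) Π_{δ=1}^B g₃(∅,Y_δ)` by counting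
ordered representatives.  This section PROVES that assertion, so that nothing in the model of `W₆^{(k)′}` rests on a reading:

* `term_eq_sum_pterm` (§8.5): for each number `n+1` of clusters, `term n = Σ_{π∈𝒫(H), |π|≤n+1} pterm π (n+1−|π|)`, where
  `pterm π B = (1/B!) Σ_{{X_γ}_{γ∈π}} Σ_{(Y₁,…,Y_B)} psummand` is the printed `({H_γ}, B)`-term verbatim (§8.5).  Mechanism:
  the labellings `f` with blocks `π` are in bijection with the injections `ι : π ↪ slots` (§8.2); for each `ι` the slots are
  `π ⊕ (the B remaining slots in increasing order)` (§8.3), along which `Σ_Z`, `ρ^T`, the fill condition and the product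
  re-index (§8.4) to the printed double sum, independently of `ι`; the `(n+1)!/B!` injections against the `1/(n+1)!` give
  the printed `1/B!`.
* `trunc_eq_sum_tsum_pterm`, `W6'_eq_printed` (§8.6): under the hypotheses of `abs_trunc_le` (absolute convergence, via the
  majorant of `abs_term_le` — `majorant_le`, `summable_fiberTerm`) the series regroups:
  `trunc = Σ_{π∈𝒫(H)} Σ'_B pterm π B` and hence `W₆′(X) = ∫₀¹dt (−(1−t)^n̄/(n̄+1)!) Σ_γ Σ_{{H_γ}} Σ_B pterm`, the display of
  p. 310 line by line.
[cite: BalabanImbrieJaffe1988, p.310 (Sect. 5.14)] -/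

section PartitionForm

open Literature.Probability.LatticeModels (IsSetPartition setPartitions mem_setPartitions blockOf hcUrsell_map)

variable {R : V → V → Prop} {nbar : ℕ} {Γ : Finset T} {loc : T → V}
  {g₃ : ℝ → (Fin (nbar + 1) → T) → Finset (Fin (nbar + 1)) → Finset V → ℝ}

/-! ### §8.1 The summand of `term`, the blocks of a labelling -/

variable (R nbar loc g₃) in
/-- The summand of the ordered form `term`: `[Adm] ρ^T(Z) Π_i g₃ᵗ(γ, f⁻¹(i), Z_i)`. [cite: BalabanImbrieJaffe1988, p.310 (Sect. 5.14)] -/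
def summand (t : ℝ) (γ : Fin (nbar + 1) → T) (X : Finset V) {n : ℕ} (Z : Fin (n + 1) → Finset V)
    (f : Fin (nbar + 1) → Fin (n + 1)) : ℝ :=
  if Adm nbar loc γ X Z f then (rhoT Z univ : ℝ) * ∏ i, g₃ t γ (fiber nbar f i) (Z i) else 0

/-- `term` is `(1/(n+1)!) Σ_Z Σ_f summand`. [cite: BalabanImbrieJaffe1988, p.310 (Sect. 5.14)] -/
theorem term_eq_sum_summand (t : ℝ) (γ : Fin (nbar + 1) → T) (X : Finset V) (n : ℕ) :
    term R nbar loc g₃ t γ X n = (1 / ((n + 1).factorial : ℝ)) *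
      ∑ Z ∈ Fintype.piFinset (fun _ : Fin (n + 1) => polys R X), ∑ f : Fin (nbar + 1) → Fin (n + 1),
        summand nbar loc g₃ t γ X Z f := rfl

/-- Membership in a fibre. [cite: BalabanImbrieJaffe1988, p.310 (Sect. 5.14)] -/
theorem mem_fiber {n : ℕ} {f : Fin (nbar + 1) → Fin n} {i : Fin n} {j : Fin (nbar + 1)} :
    j ∈ fiber nbar f i ↔ f j = i := by
  simp [fiber]

variable (nbar) in
/-- The set partition `{H_γ} ∈ 𝒫(H)` of a labelling `f : H → slots`: its non-empty fibres. [cite: BalabanImbrieJaffe1988, p.310 (Sect. 5.14)] -/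
def blocks {n : ℕ} (f : Fin (nbar + 1) → Fin n) : Finset (Finset (Fin (nbar + 1))) :=
  univ.image fun j => fiber nbar f (f j)

/-- Membership in `blocks`. [cite: BalabanImbrieJaffe1988, p.310 (Sect. 5.14)] -/
theorem mem_blocks {n : ℕ} {f : Fin (nbar + 1) → Fin n} {b : Finset (Fin (nbar + 1))} :
    b ∈ blocks nbar f ↔ ∃ j, fiber nbar f (f j) = b := by
  simp [blocks]

/-- The non-empty fibres of a labelling form a set partition of `H`. [cite: BalabanImbrieJaffe1988, p.310 (Sect. 5.14)] -/
theorem isSetPartition_blocks {n : ℕ} (f : Fin (nbar + 1) → Fin n) :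
    IsSetPartition (univ : Finset (Fin (nbar + 1))) (blocks nbar f) := by
  refine ⟨fun _ _ => subset_univ _, fun h => ?_, fun j _ => ⟨fiber nbar f (f j), mem_blocks.2 ⟨j, rfl⟩, mem_fiber.2 rfl⟩,
    fun P hP Q hQ v hvP hvQ => ?_⟩
  · obtain ⟨j, hj⟩ := mem_blocks.1 h
    have : j ∈ (∅ : Finset (Fin (nbar + 1))) := hj ▸ mem_fiber.2 rfl
    simp at this
  · obtain ⟨j₁, rfl⟩ := mem_blocks.1 hP
    obtain ⟨j₂, rfl⟩ := mem_blocks.1 hQ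
    rw [mem_fiber] at hvP hvQ
    rw [← hvP, ← hvQ]

/-- `blocks f` is a set partition of `H` (finset form). [cite: BalabanImbrieJaffe1988, p.310 (Sect. 5.14)] -/
theorem blocks_mem_setPartitions {n : ℕ} (f : Fin (nbar + 1) → Fin n) : blocks nbar f ∈ setPartitions univ :=
  mem_setPartitions.2 (isSetPartition_blocks f)

/-- All elements of a block carry the same label. [cite: BalabanImbrieJaffe1988, p.310 (Sect. 5.14)] -/
theorem apply_eq_of_mem_blocks {n : ℕ} {f : Fin (nbar + 1) → Fin n} {b : Finset (Fin (nbar + 1))}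
    (hb : b ∈ blocks nbar f) {j j' : Fin (nbar + 1)} (hj : j ∈ b) (hj' : j' ∈ b) : f j = f j' := by
  obtain ⟨j₀, rfl⟩ := mem_blocks.1 hb
  rw [mem_fiber] at hj hj'
  rw [hj, hj']

/-- A block is the fibre of the label of any of its elements. [cite: BalabanImbrieJaffe1988, p.310 (Sect. 5.14)] -/
theorem fiber_apply_eq_of_mem_blocks {n : ℕ} {f : Fin (nbar + 1) → Fin n} {b : Finset (Fin (nbar + 1))}
    (hb : b ∈ blocks nbar f) {j : Fin (nbar + 1)} (hj : j ∈ b) : fiber nbar f (f j) = b := by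
  obtain ⟨j₀, rfl⟩ := mem_blocks.1 hb
  rw [mem_fiber] at hj
  rw [hj]

/-- In `blocks f`, the block of `j` is its fibre. [cite: BalabanImbrieJaffe1988, p.310 (Sect. 5.14)] -/
theorem blockOf_blocks {n : ℕ} (f : Fin (nbar + 1) → Fin n) (j : Fin (nbar + 1)) :
    blockOf (blocks nbar f) j = fiber nbar f (f j) :=
  (isSetPartition_blocks f).eq_blockOf (mem_blocks.2 ⟨j, rfl⟩) (mem_fiber.2 rfl)

/-! ### §8.2 Labellings with prescribed blocks ↔ injections of the blocks into the slots -/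

/-- The slot of a block under a labelling `f` (the common label of its elements; junk `0` on `∅`).
[cite: BalabanImbrieJaffe1988, p.310 (Sect. 5.14)] -/
def valOf {n : ℕ} (f : Fin (nbar + 1) → Fin (n + 1)) (b : Finset (Fin (nbar + 1))) : Fin (n + 1) :=
  if h : b.Nonempty then f (b.min' h) else 0

/-- On a block, `valOf` is the label of any element. [cite: BalabanImbrieJaffe1988, p.310 (Sect. 5.14)] -/
theorem valOf_eq {n : ℕ} {f : Fin (nbar + 1) → Fin (n + 1)} {b : Finset (Fin (nbar + 1))} (hb : b ∈ blocks nbar f)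
    {j : Fin (nbar + 1)} (hj : j ∈ b) : valOf f b = f j := by
  have hne : b.Nonempty := ⟨j, hj⟩
  rw [valOf, dif_pos hne]
  exact apply_eq_of_mem_blocks hb (min'_mem b hne) hj

/-- The fibre of `valOf f b` is `b`, for a block `b`. [cite: BalabanImbrieJaffe1988, p.310 (Sect. 5.14)] -/
theorem fiber_valOf {n : ℕ} {f : Fin (nbar + 1) → Fin (n + 1)} {b : Finset (Fin (nbar + 1))} (hb : b ∈ blocks nbar f) :
    fiber nbar f (valOf f b) = b := by
  obtain ⟨j, hj⟩ := (isSetPartition_blocks f).nonempty_of_mem hb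
  rw [valOf_eq hb hj, fiber_apply_eq_of_mem_blocks hb hj]

/-- The labelling `f_{π,ι}` determined by a set partition `π` of `H` and an assignment `ι` of slots to its blocks:
`f(j) = ι(block of j)`. [cite: BalabanImbrieJaffe1988, p.310 (Sect. 5.14)] -/
def labOf {n : ℕ} (π : Finset (Finset (Fin (nbar + 1)))) (ι : π ↪ Fin (n + 1)) : Fin (nbar + 1) → Fin (n + 1) :=
  fun j => if h : blockOf π j ∈ π then ι ⟨blockOf π j, h⟩ else 0

/-- `f_{π,ι}` on a block `b ∋ j` takes the value `ι b`. [cite: BalabanImbrieJaffe1988, p.310 (Sect. 5.14)] -/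
theorem labOf_eq {n : ℕ} {π : Finset (Finset (Fin (nbar + 1)))} (hπ : IsSetPartition univ π) (ι : π ↪ Fin (n + 1))
    {b : Finset (Fin (nbar + 1))} (hb : b ∈ π) {j : Fin (nbar + 1)} (hj : j ∈ b) :
    labOf π ι j = ι ⟨b, hb⟩ := by
  have h1 : blockOf π j = b := hπ.eq_blockOf hb hj
  unfold labOf
  have h2 : blockOf π j ∈ π := h1 ▸ hb
  rw [dif_pos h2]
  congr 1
  exact Subtype.ext h1

/-- The fibre of `f_{π,ι}` over the slot `ι b` is the block `b`. [cite: BalabanImbrieJaffe1988, p.310 (Sect. 5.14)] -/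
theorem fiber_labOf {n : ℕ} {π : Finset (Finset (Fin (nbar + 1)))} (hπ : IsSetPartition univ π) (ι : π ↪ Fin (n + 1))
    (b : π) : fiber nbar (labOf π ι) (ι b) = (b : Finset (Fin (nbar + 1))) := by
  ext j
  rw [mem_fiber, labOf_eq hπ ι (hπ.blockOf_mem (mem_univ j)) (hπ.mem_blockOf (mem_univ j))]
  constructor
  · intro h
    have hb : (⟨blockOf π j, hπ.blockOf_mem (mem_univ j)⟩ : π) = b := ι.injective h
    rw [← hb]
    exact hπ.mem_blockOf (mem_univ j)
  · intro h
    congr 1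
    exact Subtype.ext (hπ.eq_blockOf b.2 h)

/-- The fibre of `f_{π,ι}` over a slot NOT assigned to a block is empty (these slots carry the `Y_δ`).
[cite: BalabanImbrieJaffe1988, p.310 (Sect. 5.14)] -/
theorem fiber_labOf_eq_empty {n : ℕ} {π : Finset (Finset (Fin (nbar + 1)))} (hπ : IsSetPartition univ π)
    (ι : π ↪ Fin (n + 1)) {i : Fin (n + 1)} (hi : ∀ b : π, ι b ≠ i) : fiber nbar (labOf π ι) i = ∅ := by
  ext j
  simp only [mem_fiber, notMem_empty, iff_false]
  rw [labOf_eq hπ ι (hπ.blockOf_mem (mem_univ j)) (hπ.mem_blockOf (mem_univ j))]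
  exact hi _

/-- The blocks of `f_{π,ι}` are `π`. [cite: BalabanImbrieJaffe1988, p.310 (Sect. 5.14)] -/
theorem blocks_labOf {n : ℕ} {π : Finset (Finset (Fin (nbar + 1)))} (hπ : IsSetPartition univ π) (ι : π ↪ Fin (n + 1)) :
    blocks nbar (labOf π ι) = π := by
  ext b
  rw [mem_blocks]
  constructor
  · rintro ⟨j, rfl⟩
    rw [labOf_eq hπ ι (hπ.blockOf_mem (mem_univ j)) (hπ.mem_blockOf (mem_univ j)), fiber_labOf hπ ι]
    exact hπ.blockOf_mem (mem_univ j)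
  · intro hb
    obtain ⟨j, hj⟩ := hπ.nonempty_of_mem hb
    refine ⟨j, ?_⟩
    rw [labOf_eq hπ ι hb hj, fiber_labOf hπ ι]

/-- `f_{π,ι} = f` when `π = blocks f` and `ι = valOf f`. [cite: BalabanImbrieJaffe1988, p.310 (Sect. 5.14)] -/
theorem labOf_valOf {n : ℕ} {f : Fin (nbar + 1) → Fin (n + 1)} {π : Finset (Finset (Fin (nbar + 1)))}
    (hf : blocks nbar f = π) (ι : π ↪ Fin (n + 1)) (hι : ∀ b : π, ι b = valOf f b) : labOf π ι = f := by
  subst hf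
  funext j
  rw [labOf_eq (isSetPartition_blocks f) ι (mem_blocks.2 ⟨j, rfl⟩) (mem_fiber.2 rfl), hι]
  exact valOf_eq (mem_blocks.2 ⟨j, rfl⟩) (mem_fiber.2 rfl)

/-- `valOf (f_{π,ι}) = ι` on the blocks of `π`. [cite: BalabanImbrieJaffe1988, p.310 (Sect. 5.14)] -/
theorem valOf_labOf {n : ℕ} {π : Finset (Finset (Fin (nbar + 1)))} (hπ : IsSetPartition univ π) (ι : π ↪ Fin (n + 1))
    (b : π) : valOf (labOf π ι) b = ι b := by
  have hb : (b : Finset (Fin (nbar + 1))) ∈ blocks nbar (labOf π ι) := by rw [blocks_labOf hπ ι]; exact b.2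
  obtain ⟨j, hj⟩ := hπ.nonempty_of_mem b.2
  rw [valOf_eq hb hj, labOf_eq hπ ι b.2 hj]

/-- **Step 2 of the re-indexing**: for a set partition `π` of `H`, summing a function of the labelling over the labellings
`f` whose blocks are `π` is summing over the injections `ι : π ↪ slots` of `F(f_{π,ι})`. [cite: BalabanImbrieJaffe1988, p.310 (Sect. 5.14)] -/
theorem sum_filter_blocks_eq_sum_embedding {n : ℕ} {π : Finset (Finset (Fin (nbar + 1)))} (hπ : IsSetPartition univ π)
    (F : (Fin (nbar + 1) → Fin (n + 1)) → ℝ) :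
    ∑ f ∈ (univ : Finset (Fin (nbar + 1) → Fin (n + 1))).filter (fun f => blocks nbar f = π), F f =
      ∑ ι : π ↪ Fin (n + 1), F (labOf π ι) := by
  refine Finset.sum_bij' (fun f hf => ⟨fun b : π => valOf f b, fun b b' h => ?_⟩) (fun ι _ => labOf π ι)
    (fun _ _ => mem_univ _) (fun ι _ => mem_filter.2 ⟨mem_univ _, blocks_labOf hπ ι⟩) ?_ ?_ ?_
  · -- injectivity on the blocks
    have hf : blocks nbar f = π := (mem_filter.1 hf).2
    have hb : (b : Finset (Fin (nbar + 1))) ∈ blocks nbar f := hf ▸ b.2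
    have hb' : (b' : Finset (Fin (nbar + 1))) ∈ blocks nbar f := hf ▸ b'.2
    apply Subtype.ext
    rw [← fiber_valOf hb, ← fiber_valOf hb']
    exact congrArg _ h
  · intro f hf
    exact labOf_valOf (mem_filter.1 hf).2 _ fun _ => rfl
  · intro ι _
    exact Function.Embedding.ext fun b => valOf_labOf hπ ι b
  · intro f hf
    rw [labOf_valOf (mem_filter.1 hf).2 _ fun _ => rfl]

/-! ### §8.3 The slots: blocks ⊕ the ordered remainder `(Y₁, …, Y_B)` -/

/-- The number of blocks is at most the number of slots when an injection exists. [cite: BalabanImbrieJaffe1988, p.310 (Sect. 5.14)] -/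
theorem card_le_of_embedding {n : ℕ} {π : Finset (Finset (Fin (nbar + 1)))} (ι : π ↪ Fin (n + 1)) : π.card ≤ n + 1 := by
  have h := Fintype.card_le_of_embedding ι
  rwa [Fintype.card_coe, Fintype.card_fin] at h

/-- The unlabelled slots (those carrying the `Y_δ`): the complement of the range of `ι`, of size `B = n+1−|π|`.
[cite: BalabanImbrieJaffe1988, p.310 (Sect. 5.14)] -/
theorem card_compl_range {n : ℕ} {π : Finset (Finset (Fin (nbar + 1)))} (ι : π ↪ Fin (n + 1)) :
    ((univ : Finset (Fin (n + 1))) \ univ.map ι).card = n + 1 - π.card := by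
  rw [card_sdiff_of_subset (subset_univ _), card_univ, Fintype.card_fin, card_map, card_univ, Fintype.card_coe]

/-- The increasing enumeration `δ ↦ (slot of Y_δ)` of the unlabelled slots. [cite: BalabanImbrieJaffe1988, p.310 (Sect. 5.14)] -/
def complEmb {n : ℕ} {π : Finset (Finset (Fin (nbar + 1)))} (ι : π ↪ Fin (n + 1)) : Fin (n + 1 - π.card) ↪o Fin (n + 1) :=
  ((univ : Finset (Fin (n + 1))) \ univ.map ι).orderEmbOfFin (card_compl_range ι)

/-- The unlabelled slots avoid the labelled ones. [cite: BalabanImbrieJaffe1988, p.310 (Sect. 5.14)] -/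
theorem complEmb_ne {n : ℕ} {π : Finset (Finset (Fin (nbar + 1)))} (ι : π ↪ Fin (n + 1)) (b : π) (δ : Fin (n + 1 - π.card)) :
    ι b ≠ complEmb ι δ := by
  intro h
  have hmem := ((univ : Finset (Fin (n + 1))) \ univ.map ι).orderEmbOfFin_mem (card_compl_range ι) δ
  rw [mem_sdiff] at hmem
  exact hmem.2 (mem_map.2 ⟨b, mem_univ _, h⟩)

/-- The slot map `blocks ⊕ Fin B → slots` is a bijection. [cite: BalabanImbrieJaffe1988, p.310 (Sect. 5.14)] -/
theorem bijective_sumElim {n : ℕ} {π : Finset (Finset (Fin (nbar + 1)))} (ι : π ↪ Fin (n + 1)) :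
    Function.Bijective (Sum.elim ι (complEmb ι) : π ⊕ Fin (n + 1 - π.card) → Fin (n + 1)) := by
  rw [Fintype.bijective_iff_injective_and_card]
  refine ⟨ι.injective.sumElim (complEmb ι).injective fun b δ => complEmb_ne ι b δ, ?_⟩
  rw [Fintype.card_sum, Fintype.card_coe, Fintype.card_fin, Fintype.card_fin]
  have := card_le_of_embedding ι
  omega

/-- The slot bijection `e_ι : blocks ⊕ Fin B ≃ slots`, `e_ι(inl b) = ι b`, `e_ι(inr δ) =` the `δ`-th unlabelled slot.
[cite: BalabanImbrieJaffe1988, p.310 (Sect. 5.14)] -/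
def slotEquiv {n : ℕ} {π : Finset (Finset (Fin (nbar + 1)))} (ι : π ↪ Fin (n + 1)) : π ⊕ Fin (n + 1 - π.card) ≃ Fin (n + 1) :=
  Equiv.ofBijective _ (bijective_sumElim ι)

/-- `e_ι (inl b) = ι b`. [cite: BalabanImbrieJaffe1988, p.310 (Sect. 5.14)] -/
@[simp] theorem slotEquiv_inl {n : ℕ} {π : Finset (Finset (Fin (nbar + 1)))} (ι : π ↪ Fin (n + 1)) (b : π) :
    slotEquiv ι (Sum.inl b) = ι b := rfl

/-- `e_ι (inr δ) = complEmb ι δ`. [cite: BalabanImbrieJaffe1988, p.310 (Sect. 5.14)] -/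
@[simp] theorem slotEquiv_inr {n : ℕ} {π : Finset (Finset (Fin (nbar + 1)))} (ι : π ↪ Fin (n + 1)) (δ : Fin (n + 1 - π.card)) :
    slotEquiv ι (Sum.inr δ) = complEmb ι δ := rfl

/-! ### §8.4 Re-indexing sums, products, unions and `ρ^T` along a slot bijection -/

omit [DecidableEq V] in
/-- Re-indexing the cluster tuples along a bijection of the index type. [cite: BalabanImbrieJaffe1988, p.310 (Sect. 5.14)] -/
theorem sum_piFinset_comp_equiv {κ S : Type} [Fintype κ] [DecidableEq κ] [Fintype S] [DecidableEq S] (e : κ ≃ S)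
    (Q : Finset (Finset V)) (F : (S → Finset V) → ℝ) :
    ∑ Z ∈ Fintype.piFinset (fun _ : S => Q), F Z = ∑ W ∈ Fintype.piFinset (fun _ : κ => Q), F (W ∘ e.symm) := by
  refine (Finset.sum_equiv (e.arrowCongr (Equiv.refl (Finset V))) (fun W => ?_) (fun W _ => ?_)).symm
  · simp only [Fintype.mem_piFinset, Equiv.arrowCongr_apply, Equiv.coe_refl, Function.comp_apply, id_eq]
    exact ⟨fun h s => h _, fun h k => by simpa using h (e k)⟩
  · rfl

omit [DecidableEq V] in
/-- Splitting the tuples indexed by a sum type into the pairs `(Xc, Y)`. [cite: BalabanImbrieJaffe1988, p.310 (Sect. 5.14)] -/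
theorem sum_piFinset_sum_type {α β : Type} [Fintype α] [DecidableEq α] [Fintype β] [DecidableEq β] (Q : Finset (Finset V))
    (F : (α ⊕ β → Finset V) → ℝ) :
    ∑ W ∈ Fintype.piFinset (fun _ : α ⊕ β => Q), F W =
      ∑ Xc ∈ Fintype.piFinset (fun _ : α => Q), ∑ Y ∈ Fintype.piFinset (fun _ : β => Q), F (Sum.elim Xc Y) := by
  rw [← Finset.sum_product']
  refine Finset.sum_equiv (Equiv.sumArrowEquivProdArrow α β (Finset V)) (fun W => ?_) (fun W _ => ?_)
  · simp only [Fintype.mem_piFinset, mem_product, Equiv.sumArrowEquivProdArrow_apply_fst,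
      Equiv.sumArrowEquivProdArrow_apply_snd, Sum.forall]
  · change F W = F (Sum.elim (W ∘ Sum.inl) (W ∘ Sum.inr))
    rw [Sum.elim_comp_inl_inr]

/-- `ρ^T` is invariant under relabelling the clusters (hard-core Ursell coefficients of isomorphic graphs agree).
[cite: BalabanImbrieJaffe1988, p.310 (Sect. 5.14)] -/
theorem rhoT_comp_equiv_symm {κ S : Type} [Fintype κ] [DecidableEq κ] [Fintype S] [DecidableEq S] (e : κ ≃ S)
    (W : κ → Finset V) : rhoT (W ∘ e.symm) univ = rhoT W univ := by
  have h := hcUrsell_map e.toEmbedding (H := overlapGraph W) (H' := overlapGraph (W ∘ e.symm))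
    (fun a b => by simp [overlapGraph]) univ
  rw [Finset.map_univ_equiv] at h
  exact h

/-- Unions are invariant under relabelling. [cite: BalabanImbrieJaffe1988, p.310 (Sect. 5.14)] -/
theorem biUnion_comp_equiv_symm {κ S : Type} [Fintype κ] [DecidableEq κ] [Fintype S] [DecidableEq S] (e : κ ≃ S)
    (W : κ → Finset V) : (univ : Finset S).biUnion (W ∘ e.symm) = (univ : Finset κ).biUnion W := by
  ext x
  simp only [mem_biUnion, mem_univ, true_and, Function.comp_apply]
  exact ⟨fun ⟨s, hs⟩ => ⟨e.symm s, hs⟩, fun ⟨k, hk⟩ => ⟨e k, by simpa using hk⟩⟩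

omit [DecidableEq V] in
/-- The union over a sum type splits. [cite: BalabanImbrieJaffe1988, p.310 (Sect. 5.14)] -/
theorem biUnion_sum_elim [DecidableEq V] {α β : Type} [Fintype α] [Fintype β] (Xc : α → Finset V) (Y : β → Finset V) :
    (univ : Finset (α ⊕ β)).biUnion (Sum.elim Xc Y) = univ.biUnion Xc ∪ univ.biUnion Y := by
  ext x
  simp only [mem_biUnion, mem_univ, true_and, mem_union, Sum.exists, Sum.elim_inl, Sum.elim_inr]

/-! ### §8.5 The printed (π, B)-term and the identity -/

variable (R nbar loc g₃) in
/-- The printed summand for the partition `{H_γ} = π`, labelled clusters `X_γ = Xc γ` and the ordered remainder `(Y₁,…,Y_B)`: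
`[⋃X_γ ∪ ⋃Y_δ = X, each X_γ covers the derivatives of H_γ] ρ^T(X's,Y's) Π_γ g₃(H_γ,X_γ) Π_δ g₃(∅,Y_δ)`.
[cite: BalabanImbrieJaffe1988, p.310 (Sect. 5.14)] -/
def psummand (t : ℝ) (γ : Fin (nbar + 1) → T) (X : Finset V) (π : Finset (Finset (Fin (nbar + 1)))) {B : ℕ}
    (Xc : π → Finset V) (Y : Fin B → Finset V) : ℝ :=
  if univ.biUnion Xc ∪ univ.biUnion Y = X ∧ ∀ b : π, ∀ j ∈ (b : Finset (Fin (nbar + 1))), loc (γ j) ∈ Xc b then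
    (rhoT (Sum.elim Xc Y) univ : ℝ) *
      ((∏ b : π, g₃ t γ (b : Finset (Fin (nbar + 1))) (Xc b)) * ∏ δ, g₃ t γ ∅ (Y δ))
  else 0

variable (R nbar loc g₃) in
/-- **The printed `({H_γ}, B)`-term** of p. 310: `(1/B!) Σ_{{X_γ}} Σ_{(Y₁,…,Y_B)} psummand` (clusters ranging over the polymers
inside `X`). [cite: BalabanImbrieJaffe1988, p.310 (Sect. 5.14)] -/
def pterm (t : ℝ) (γ : Fin (nbar + 1) → T) (X : Finset V) (π : Finset (Finset (Fin (nbar + 1)))) (B : ℕ) : ℝ :=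
  (1 / (B.factorial : ℝ)) *
    ∑ Xc ∈ Fintype.piFinset (fun _ : π => polys R X), ∑ Y ∈ Fintype.piFinset (fun _ : Fin B => polys R X),
      psummand nbar loc g₃ t γ X π Xc Y

/-- **Step 3 of the re-indexing**: for fixed `π` and `ι`, the sum over the ordered tuples `Z` of the ordered summand at the
labelling `f_{π,ι}` IS the printed double sum over `{X_γ}`, `(Y₁,…,Y_B)` (`B = n+1−|π|`), by the slot bijection `e_ι`.
[cite: BalabanImbrieJaffe1988, p.310 (Sect. 5.14)] -/
theorem sum_summand_labOf {n : ℕ} {π : Finset (Finset (Fin (nbar + 1)))} (hπ : IsSetPartition univ π) (ι : π ↪ Fin (n + 1))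
    (t : ℝ) (γ : Fin (nbar + 1) → T) (X : Finset V) :
    ∑ Z ∈ Fintype.piFinset (fun _ : Fin (n + 1) => polys R X), summand nbar loc g₃ t γ X Z (labOf π ι) =
      ∑ Xc ∈ Fintype.piFinset (fun _ : π => polys R X),
        ∑ Y ∈ Fintype.piFinset (fun _ : Fin (n + 1 - π.card) => polys R X), psummand nbar loc g₃ t γ X π Xc Y := by
  rw [sum_piFinset_comp_equiv (slotEquiv ι), sum_piFinset_sum_type]
  refine sum_congr rfl fun Xc _ => sum_congr rfl fun Y _ => ?_
  set e := slotEquiv ι with he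
  -- the admissibility conditions agree
  have hcover : (∀ j, loc (γ j) ∈ (Sum.elim Xc Y ∘ e.symm) (labOf π ι j)) ↔
      ∀ b : π, ∀ j ∈ (b : Finset (Fin (nbar + 1))), loc (γ j) ∈ Xc b := by
    have hval : ∀ j, (Sum.elim Xc Y ∘ e.symm) (labOf π ι j) = Xc ⟨blockOf π j, hπ.blockOf_mem (mem_univ j)⟩ := by
      intro j
      rw [labOf_eq hπ ι (hπ.blockOf_mem (mem_univ j)) (hπ.mem_blockOf (mem_univ j)), Function.comp_apply,
        ← slotEquiv_inl ι, ← he, Equiv.symm_apply_apply, Sum.elim_inl]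
    simp_rw [hval]
    constructor
    · intro h b j hj
      have hb : (⟨blockOf π j, hπ.blockOf_mem (mem_univ j)⟩ : π) = b := Subtype.ext (hπ.eq_blockOf b.2 hj)
      rw [← hb]
      exact h j
    · intro h j
      exact h _ j (hπ.mem_blockOf (mem_univ j))
  have hAdm : Adm nbar loc γ X (Sum.elim Xc Y ∘ e.symm) (labOf π ι) ↔
      (univ.biUnion Xc ∪ univ.biUnion Y = X ∧ ∀ b : π, ∀ j ∈ (b : Finset (Fin (nbar + 1))), loc (γ j) ∈ Xc b) := by
    unfold Adm
    rw [biUnion_comp_equiv_symm, biUnion_sum_elim, hcover]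
  unfold summand psummand
  by_cases hA : univ.biUnion Xc ∪ univ.biUnion Y = X ∧ ∀ b : π, ∀ j ∈ (b : Finset (Fin (nbar + 1))), loc (γ j) ∈ Xc b
  · rw [if_pos (hAdm.2 hA), if_pos hA, rhoT_comp_equiv_symm]
    congr 1
    rw [← Equiv.prod_comp e (fun i => g₃ t γ (fiber nbar (labOf π ι) i) ((Sum.elim Xc Y ∘ e.symm) i)),
      Fintype.prod_sum_type]
    congr 1
    · refine prod_congr rfl fun b _ => ?_
      rw [he, slotEquiv_inl, fiber_labOf hπ ι, Function.comp_apply, ← slotEquiv_inl ι, Equiv.symm_apply_apply,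
        Sum.elim_inl]
    · refine prod_congr rfl fun δ _ => ?_
      rw [he, slotEquiv_inr, fiber_labOf_eq_empty hπ ι (fun b => complEmb_ne ι b δ), Function.comp_apply,
        ← slotEquiv_inr ι, Equiv.symm_apply_apply, Sum.elim_inr]
  · rw [if_neg (fun h => hA (hAdm.1 h)), if_neg hA]

/-- The number of assignments of slots to the blocks: `#(π ↪ slots) = (n+1)!/(n+1−|π|)!`. [cite: BalabanImbrieJaffe1988, p.310 (Sect. 5.14)] -/
theorem card_embedding_blocks {n : ℕ} (π : Finset (Finset (Fin (nbar + 1)))) :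
    Fintype.card (π ↪ Fin (n + 1)) = (n + 1).descFactorial π.card := by
  rw [Fintype.card_embedding_eq, Fintype.card_coe, Fintype.card_fin]

/-- The weights: `(1/(n+1)!)·(n+1)!/(n+1−m)! = 1/(n+1−m)!` (`m ≤ n+1`), and `= 0`-compatible for `m > n+1`.
[cite: BalabanImbrieJaffe1988, p.310 (Sect. 5.14)] -/
theorem descFactorial_div_factorial {n m : ℕ} (h : m ≤ n + 1) :
    ((n + 1).descFactorial m : ℝ) / ((n + 1).factorial : ℝ) = 1 / ((n + 1 - m).factorial : ℝ) := by
  have key : ((n + 1 - m).factorial : ℝ) * ((n + 1).descFactorial m : ℝ) = ((n + 1).factorial : ℝ) := by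
    exact_mod_cast Nat.factorial_mul_descFactorial h
  rw [div_eq_div_iff (by positivity) (by positivity), one_mul, ← key, mul_comm]

variable (R nbar loc g₃) in
/-- The part of the ordered term carried by the labellings with blocks `π`: `(1/(n+1)!) Σ_{f : blocks f = π} Σ_Z summand`.
[cite: BalabanImbrieJaffe1988, p.310 (Sect. 5.14)] -/
def fiberTerm (t : ℝ) (γ : Fin (nbar + 1) → T) (X : Finset V) (π : Finset (Finset (Fin (nbar + 1)))) (n : ℕ) : ℝ :=
  (1 / ((n + 1).factorial : ℝ)) *
    ∑ f ∈ (univ : Finset (Fin (nbar + 1) → Fin (n + 1))).filter (fun f => blocks nbar f = π),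
      ∑ Z ∈ Fintype.piFinset (fun _ : Fin (n + 1) => polys R X), summand nbar loc g₃ t γ X Z f

/-- The ordered term regrouped by the blocks of the labelling: `term n = Σ_{π ∈ 𝒫(H)} fiberTerm π n`.
[cite: BalabanImbrieJaffe1988, p.310 (Sect. 5.14)] -/
theorem term_eq_sum_fiberTerm (t : ℝ) (γ : Fin (nbar + 1) → T) (X : Finset V) (n : ℕ) :
    term R nbar loc g₃ t γ X n = ∑ π ∈ setPartitions (univ : Finset (Fin (nbar + 1))), fiberTerm R nbar loc g₃ t γ X π n := by
  rw [term_eq_sum_summand, sum_comm,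
    ← sum_fiberwise_of_maps_to (g := blocks nbar) (t := setPartitions univ) (fun f _ => blocks_mem_setPartitions f),
    mul_sum]
  rfl

/-- **READING (iv), block by block**: for a set partition `π` of `H`, the labellings with blocks `π` contribute exactly the
printed `(π, B)`-term with `B = n+1−|π|` (and nothing when `|π| > n+1`): `Σ_ι` of the ι-independent printed double sum gives
the multiplicity `(n+1)!/B!`, against the `1/(n+1)!`. [cite: BalabanImbrieJaffe1988, p.310 (Sect. 5.14)] -/
theorem fiberTerm_eq {π : Finset (Finset (Fin (nbar + 1)))} (hπ : IsSetPartition univ π) (t : ℝ) (γ : Fin (nbar + 1) → T)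
    (X : Finset V) (n : ℕ) :
    fiberTerm R nbar loc g₃ t γ X π n = if π.card ≤ n + 1 then pterm R nbar loc g₃ t γ X π (n + 1 - π.card) else 0 := by
  unfold fiberTerm
  rw [sum_filter_blocks_eq_sum_embedding hπ]
  simp_rw [sum_summand_labOf hπ]
  rw [sum_const, card_univ, card_embedding_blocks, nsmul_eq_mul, ← mul_assoc]
  by_cases hm : π.card ≤ n + 1
  · rw [if_pos hm, pterm, div_mul_eq_mul_div, one_mul, descFactorial_div_factorial hm]
  · rw [if_neg hm, (Nat.descFactorial_eq_zero_iff_lt.2 (by omega) : (n + 1).descFactorial π.card = 0)]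
    simp

/-- **READING (iv) AS A THEOREM**: the ordered term with `n+1` clusters equals the sum over the set partitions `{H_γ}` of `H`
with `|π| ≤ n+1` of the printed `(π, B)`-terms with `B = n+1−|π|` unlabelled clusters — each printed term `({H_γ}, {X_γ},
(Y₁,…,Y_B))` with its weight `1/B!` is the `(n+1)!/B!` ordered terms `(Z, f)` with blocks `{H_γ}`, weighted `1/(n+1)!`.
[cite: BalabanImbrieJaffe1988, p.310 (Sect. 5.14)] -/
theorem term_eq_sum_pterm (t : ℝ) (γ : Fin (nbar + 1) → T) (X : Finset V) (n : ℕ) :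
    term R nbar loc g₃ t γ X n =
      ∑ π ∈ setPartitions (univ : Finset (Fin (nbar + 1))),
        if π.card ≤ n + 1 then pterm R nbar loc g₃ t γ X π (n + 1 - π.card) else 0 := by
  rw [term_eq_sum_fiberTerm]
  exact sum_congr rfl fun π hπ => fiberTerm_eq (mem_setPartitions.1 hπ) t γ X n

/-! ### §8.6 The series: `trunc = Σ_{{H_γ}} Σ'_B pterm` and `W₆′` in the printed form -/

variable {nbr : V → Finset V} {Δ : ℕ} {θ β' : ℝ}

/-- The absolute majorant of the ordered summands (steps (a)–(c), as in `abs_term_le`, without cancellations):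
`(1/(n+1)!) Σ_Z Σ_f |summand| ≤ θ^{(1−β′)(n̄+1)} θ^{(β′/2)|X|} (n̄+1)! · (1/(n+1)!) Σ_Z |ρ^T(Z)| Π_i w(Z_i)`.
[cite: BalabanImbrieJaffe1988, p.310 (Sect. 5.14)] -/
theorem majorant_le (hθ0 : 0 < θ) (hθ1 : θ ≤ 1) (hβ : 0 ≤ β')
    (h5144 : ∀ t ∈ Set.Icc (0 : ℝ) 1, ∀ (γ : Fin (nbar + 1) → T) (K : Finset (Fin (nbar + 1))) (Y : Finset V),
      (∀ j ∈ K, loc (γ j) ∈ Y) → |g₃ t γ K Y| ≤ θ ^ ((K.card : ℝ) + β' * ((Y \ K.image fun j => loc (γ j)).card : ℝ)))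
    {t : ℝ} (ht : t ∈ Set.Icc (0 : ℝ) 1) (γ : Fin (nbar + 1) → T) (X : Finset V) (n : ℕ) :
    (1 / ((n + 1).factorial : ℝ)) * ∑ Z ∈ Fintype.piFinset (fun _ : Fin (n + 1) => polys R X),
        ∑ f : Fin (nbar + 1) → Fin (n + 1), |summand nbar loc g₃ t γ X Z f| ≤
      θ ^ ((1 - β') * (nbar + 1)) * θ ^ (β' / 2 * X.card) * (nbar + 1).factorial *
        ((1 / ((n + 1).factorial : ℝ)) * ∑ Z ∈ Fintype.piFinset (fun _ : Fin (n + 1) => polys R X),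
          |(rhoT Z univ : ℝ)| * ∏ i, wt (θ ^ (β' / 2)) (Z i)) := by
  classical
  set C : ℝ := θ ^ ((1 - β') * (nbar + 1)) * θ ^ (β' / 2 * X.card) with hC
  have hC0 : 0 ≤ C := mul_nonneg (Real.rpow_nonneg hθ0.le _) (Real.rpow_nonneg hθ0.le _)
  have hσ : 0 ≤ θ ^ (β' / 2) := Real.rpow_nonneg hθ0.le _
  have hZf : ∀ Z ∈ Fintype.piFinset (fun _ : Fin (n + 1) => polys R X), ∀ f : Fin (nbar + 1) → Fin (n + 1),
      |summand nbar loc g₃ t γ X Z f| ≤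
        (if ∀ j, loc (γ j) ∈ Z (f j) then 1 else 0) * (C * (|(rhoT Z univ : ℝ)| * ∏ i, (θ ^ (β' / 2)) ^ (Z i).card)) := by
    intro Z hZ f
    unfold summand
    by_cases hA : Adm nbar loc γ X Z f
    · rw [if_pos hA, if_pos hA.2, one_mul, abs_mul, abs_prod]
      have hprod : ∏ i, |g₃ t γ (fiber nbar f i) (Z i)| ≤
          θ ^ ((1 - β') * (nbar + 1)) * θ ^ (β' * ∑ i, ((Z i).card : ℝ)) :=
        prod_abs_g3_le hθ0 hθ1 hβ fun i => h5144 t ht γ _ _ fun j hj => by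
          have := (mem_filter.1 hj).2
          rw [← this]; exact hA.2 j
      have hfill := rpow_fill_le hθ0 hθ1 hβ (β' := β') hA.1
      have hpow : ∏ i, θ ^ (β' / 2 * ((Z i).card : ℝ)) = ∏ i, (θ ^ (β' / 2)) ^ (Z i).card :=
        prod_congr rfl fun i _ => by rw [Real.rpow_mul hθ0.le, Real.rpow_natCast]
      calc |(rhoT Z univ : ℝ)| * ∏ i, |g₃ t γ (fiber nbar f i) (Z i)|
          ≤ |(rhoT Z univ : ℝ)| * (θ ^ ((1 - β') * (nbar + 1)) *
              (θ ^ (β' / 2 * X.card) * ∏ i, θ ^ (β' / 2 * ((Z i).card : ℝ)))) :=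
            mul_le_mul_of_nonneg_left (hprod.trans (mul_le_mul_of_nonneg_left hfill (Real.rpow_nonneg hθ0.le _)))
              (abs_nonneg _)
        _ = C * (|(rhoT Z univ : ℝ)| * ∏ i, (θ ^ (β' / 2)) ^ (Z i).card) := by rw [hpow, hC]; ring
    · rw [if_neg hA, abs_zero]
      exact mul_nonneg (by split_ifs <;> norm_num) (mul_nonneg hC0 (mul_nonneg (abs_nonneg _)
        (prod_nonneg fun i _ => pow_nonneg hσ _)))
  have hZ : ∀ Z ∈ Fintype.piFinset (fun _ : Fin (n + 1) => polys R X),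
      ∑ f : Fin (nbar + 1) → Fin (n + 1), |summand nbar loc g₃ t γ X Z f| ≤
        C * (nbar + 1).factorial * (|(rhoT Z univ : ℝ)| * ∏ i, wt (θ ^ (β' / 2)) (Z i)) := by
    intro Z hZ
    have hmult := card_labellings_le (loc := loc) γ Z
    have hB0 : 0 ≤ C * (|(rhoT Z univ : ℝ)| * ∏ i, (θ ^ (β' / 2)) ^ (Z i).card) :=
      mul_nonneg hC0 (mul_nonneg (abs_nonneg _) (prod_nonneg fun i _ => pow_nonneg hσ _))
    calc ∑ f : Fin (nbar + 1) → Fin (n + 1), |summand nbar loc g₃ t γ X Z f|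
        ≤ ∑ f : Fin (nbar + 1) → Fin (n + 1), (if ∀ j, loc (γ j) ∈ Z (f j) then 1 else 0) *
            (C * (|(rhoT Z univ : ℝ)| * ∏ i, (θ ^ (β' / 2)) ^ (Z i).card)) := sum_le_sum fun f _ => hZf Z hZ f
      _ = (((univ : Finset (Fin (nbar + 1) → Fin (n + 1))).filter fun f => ∀ j, loc (γ j) ∈ Z (f j)).card : ℝ) *
            (C * (|(rhoT Z univ : ℝ)| * ∏ i, (θ ^ (β' / 2)) ^ (Z i).card)) := by
          rw [← sum_mul, ← sum_filter, sum_const, nsmul_eq_mul, mul_one]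
      _ ≤ ((nbar + 1).factorial * Real.exp (∑ i, ((Z i).card : ℝ))) *
            (C * (|(rhoT Z univ : ℝ)| * ∏ i, (θ ^ (β' / 2)) ^ (Z i).card)) :=
          mul_le_mul_of_nonneg_right hmult hB0
      _ = C * (nbar + 1).factorial * (|(rhoT Z univ : ℝ)| * ∏ i, wt (θ ^ (β' / 2)) (Z i)) := by
          simp only [wt]
          rw [prod_mul_distrib, ← Real.exp_sum]
          ring
  have hfac : 0 ≤ (1 / ((n + 1).factorial : ℝ)) := by positivity
  calc (1 / ((n + 1).factorial : ℝ)) * ∑ Z ∈ Fintype.piFinset (fun _ : Fin (n + 1) => polys R X),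
          ∑ f : Fin (nbar + 1) → Fin (n + 1), |summand nbar loc g₃ t γ X Z f|
      ≤ (1 / ((n + 1).factorial : ℝ)) * ∑ Z ∈ Fintype.piFinset (fun _ : Fin (n + 1) => polys R X),
          C * (nbar + 1).factorial * (|(rhoT Z univ : ℝ)| * ∏ i, wt (θ ^ (β' / 2)) (Z i)) :=
        mul_le_mul_of_nonneg_left (sum_le_sum hZ) hfac
    _ = _ := by rw [← mul_sum, hC]; ring

/-- Each block-part of the ordered series is absolutely summable in the number of clusters (dominated by the majorant of
`abs_term_le`, whose partial sums are bounded by `partialSum_le`). [cite: BalabanImbrieJaffe1988, p.310 (Sect. 5.14)] -/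
theorem summable_fiberTerm (hR : ∀ x y, R x y → R y x) (hΔ : ∀ x, (nbr x).card ≤ Δ) (hnbr : ∀ x y, R x y → y ∈ nbr x)
    (hθ0 : 0 < θ) (hθ1 : θ ≤ 1) (hβ : 0 ≤ β')
    (hsmall : 16 * ((Δ : ℝ) + 1) ^ 2 * (θ ^ (β' / 2) * Real.exp 2) ≤ 1)
    (h5144 : ∀ t ∈ Set.Icc (0 : ℝ) 1, ∀ (γ : Fin (nbar + 1) → T) (K : Finset (Fin (nbar + 1))) (Y : Finset V),
      (∀ j ∈ K, loc (γ j) ∈ Y) → |g₃ t γ K Y| ≤ θ ^ ((K.card : ℝ) + β' * ((Y \ K.image fun j => loc (γ j)).card : ℝ)))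
    {t : ℝ} (ht : t ∈ Set.Icc (0 : ℝ) 1) (γ : Fin (nbar + 1) → T) (X : Finset V) (π : Finset (Finset (Fin (nbar + 1)))) :
    Summable fun n => fiberTerm R nbar loc g₃ t γ X π n := by
  -- the majorant
  set M : ℕ → ℝ := fun n => (1 / ((n + 1).factorial : ℝ)) * ∑ Z ∈ Fintype.piFinset (fun _ : Fin (n + 1) => polys R X),
    ∑ f : Fin (nbar + 1) → Fin (n + 1), |summand nbar loc g₃ t γ X Z f| with hM
  have hM0 : ∀ n, 0 ≤ M n := fun n => mul_nonneg (by positivity) (sum_nonneg fun _ _ => sum_nonneg fun _ _ => abs_nonneg _)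
  have hMsum : Summable M := by
    refine summable_of_sum_range_le hM0 (c := θ ^ ((1 - β') * (nbar + 1)) * θ ^ (β' / 2 * X.card) *
      (nbar + 1).factorial * (2 * (2 * (θ ^ (β' / 2) * Real.exp 2)) * X.card)) fun N => ?_
    have hC0 : 0 ≤ θ ^ ((1 - β') * (nbar + 1)) * θ ^ (β' / 2 * X.card) * (nbar + 1).factorial :=
      mul_nonneg (mul_nonneg (Real.rpow_nonneg hθ0.le _) (Real.rpow_nonneg hθ0.le _)) (Nat.cast_nonneg _)
    calc ∑ n ∈ range N, M n
        ≤ ∑ n ∈ range N, θ ^ ((1 - β') * (nbar + 1)) * θ ^ (β' / 2 * X.card) * (nbar + 1).factorial *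
            ((1 / ((n + 1).factorial : ℝ)) * ∑ Z ∈ Fintype.piFinset (fun _ : Fin (n + 1) => polys R X),
              |(rhoT Z univ : ℝ)| * ∏ i, wt (θ ^ (β' / 2)) (Z i)) :=
          sum_le_sum fun n _ => majorant_le hθ0 hθ1 hβ h5144 ht γ X n
      _ = θ ^ ((1 - β') * (nbar + 1)) * θ ^ (β' / 2 * X.card) * (nbar + 1).factorial *
            ∑ n ∈ range N, ((1 / ((n + 1).factorial : ℝ)) *
              ∑ Z ∈ Fintype.piFinset (fun _ : Fin (n + 1) => polys R X),
                |(rhoT Z univ : ℝ)| * ∏ i, wt (θ ^ (β' / 2)) (Z i)) := by rw [mul_sum]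
      _ ≤ _ := mul_le_mul_of_nonneg_left (partialSum_le hR hΔ hnbr (Real.rpow_nonneg hθ0.le _) hsmall X N) hC0
  refine Summable.of_norm_bounded hMsum fun n => ?_
  rw [Real.norm_eq_abs]
  -- |fiberTerm π n| ≤ M n
  have hfac : 0 ≤ (1 / ((n + 1).factorial : ℝ)) := by positivity
  unfold fiberTerm
  rw [abs_mul, abs_of_nonneg hfac, hM]
  refine mul_le_mul_of_nonneg_left ?_ hfac
  calc |∑ f ∈ (univ : Finset (Fin (nbar + 1) → Fin (n + 1))).filter (fun f => blocks nbar f = π),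
          ∑ Z ∈ Fintype.piFinset (fun _ : Fin (n + 1) => polys R X), summand nbar loc g₃ t γ X Z f|
      ≤ ∑ f ∈ (univ : Finset (Fin (nbar + 1) → Fin (n + 1))).filter (fun f => blocks nbar f = π),
          ∑ Z ∈ Fintype.piFinset (fun _ : Fin (n + 1) => polys R X), |summand nbar loc g₃ t γ X Z f| :=
        (abs_sum_le_sum_abs _ _).trans (sum_le_sum fun f _ => abs_sum_le_sum_abs _ _)
    _ ≤ ∑ f : Fin (nbar + 1) → Fin (n + 1),
          ∑ Z ∈ Fintype.piFinset (fun _ : Fin (n + 1) => polys R X), |summand nbar loc g₃ t γ X Z f| :=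
        sum_le_sum_of_subset_of_nonneg (filter_subset _ _) fun f _ _ => sum_nonneg fun _ _ => abs_nonneg _
    _ = ∑ Z ∈ Fintype.piFinset (fun _ : Fin (n + 1) => polys R X),
          ∑ f : Fin (nbar + 1) → Fin (n + 1), |summand nbar loc g₃ t γ X Z f| := sum_comm

/-- A set partition of the (non-empty) slot set `H` has at least one block. [cite: BalabanImbrieJaffe1988, p.310 (Sect. 5.14)] -/
theorem one_le_card_of_mem_setPartitions {π : Finset (Finset (Fin (nbar + 1)))} (hπ : π ∈ setPartitions univ) :
    1 ≤ π.card := by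
  obtain ⟨P, hP, -⟩ := (mem_setPartitions.1 hπ).exists_mem (mem_univ (0 : Fin (nbar + 1)))
  exact card_pos.2 ⟨P, hP⟩

/-- **THE SERIES IN THE PRINTED FORM**: under the hypotheses of `abs_trunc_le` (absolute convergence),
`⟨Π_{j∈H}[;(d/dt)_{γ_j}]⟩_t` restricted to the fillings of `X` equals `Σ_{{H_γ}∈𝒫(H)} Σ'_B (1/B!) Σ_{{X_γ}} Σ_{(Y₁,…,Y_B)} …` —
the p. 310 display, the series over the number `B` of unlabelled clusters. [cite: BalabanImbrieJaffe1988, p.310 (Sect. 5.14)] -/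
theorem trunc_eq_sum_tsum_pterm (hR : ∀ x y, R x y → R y x) (hΔ : ∀ x, (nbr x).card ≤ Δ)
    (hnbr : ∀ x y, R x y → y ∈ nbr x) (hθ0 : 0 < θ) (hθ1 : θ ≤ 1) (hβ : 0 ≤ β')
    (hsmall : 16 * ((Δ : ℝ) + 1) ^ 2 * (θ ^ (β' / 2) * Real.exp 2) ≤ 1)
    (h5144 : ∀ t ∈ Set.Icc (0 : ℝ) 1, ∀ (γ : Fin (nbar + 1) → T) (K : Finset (Fin (nbar + 1))) (Y : Finset V),
      (∀ j ∈ K, loc (γ j) ∈ Y) → |g₃ t γ K Y| ≤ θ ^ ((K.card : ℝ) + β' * ((Y \ K.image fun j => loc (γ j)).card : ℝ)))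
    {t : ℝ} (ht : t ∈ Set.Icc (0 : ℝ) 1) (γ : Fin (nbar + 1) → T) (X : Finset V) :
    trunc R nbar loc g₃ t γ X =
      ∑ π ∈ setPartitions (univ : Finset (Fin (nbar + 1))), ∑' B, pterm R nbar loc g₃ t γ X π B := by
  have hsum : ∀ π ∈ setPartitions (univ : Finset (Fin (nbar + 1))), Summable fun n => fiberTerm R nbar loc g₃ t γ X π n :=
    fun π _ => summable_fiberTerm hR hΔ hnbr hθ0 hθ1 hβ hsmall h5144 ht γ X π
  unfold trunc
  simp_rw [term_eq_sum_fiberTerm]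
  rw [Summable.tsum_finsetSum hsum]
  refine sum_congr rfl fun π hπ' => ?_
  have hπ : IsSetPartition univ π := mem_setPartitions.1 hπ'
  have hm : 1 ≤ π.card := one_le_card_of_mem_setPartitions hπ'
  -- shift the index: the terms with `n + 1 < |π|` vanish, `n = B + (|π| − 1)`
  have hshift := (hsum π hπ').sum_add_tsum_nat_add (π.card - 1)
  have hzero : ∑ i ∈ range (π.card - 1), fiberTerm R nbar loc g₃ t γ X π i = 0 := by
    refine sum_eq_zero fun i hi => ?_
    rw [fiberTerm_eq hπ, if_neg]
    have := mem_range.1 hi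
    omega
  rw [hzero, zero_add] at hshift
  rw [← hshift]
  refine tsum_congr fun B => ?_
  rw [fiberTerm_eq hπ, if_pos (by omega)]
  congr 1
  omega

/-- **W₆^{(k)′} IN THE PRINTED FORM** (p. 310, verbatim structure): under the same hypotheses,
`W₆′(X) = ∫₀¹dt (−(1−t)^n̄/(n̄+1)!) Σ_{{γ_j}} Σ_{{H_γ}∈𝒫(H)} Σ_B (1/B!) Σ_{{X_γ}} Σ_{(Y₁,…,Y_B)} [fill X] ρ^T Π_γ g₃(H_γ,X_γ) Π_δ g₃(∅,Y_δ)`.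
[cite: BalabanImbrieJaffe1988, p.310 (Sect. 5.14)] -/
theorem W6'_eq_printed (hR : ∀ x y, R x y → R y x) (hΔ : ∀ x, (nbr x).card ≤ Δ) (hnbr : ∀ x y, R x y → y ∈ nbr x)
    (hθ0 : 0 < θ) (hθ1 : θ ≤ 1) (hβ : 0 ≤ β')
    (hsmall : 16 * ((Δ : ℝ) + 1) ^ 2 * (θ ^ (β' / 2) * Real.exp 2) ≤ 1)
    (h5144 : ∀ t ∈ Set.Icc (0 : ℝ) 1, ∀ (γ : Fin (nbar + 1) → T) (K : Finset (Fin (nbar + 1))) (Y : Finset V),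
      (∀ j ∈ K, loc (γ j) ∈ Y) → |g₃ t γ K Y| ≤ θ ^ ((K.card : ℝ) + β' * ((Y \ K.image fun j => loc (γ j)).card : ℝ)))
    (X : Finset V) :
    W6' R nbar Γ loc g₃ X = ∫ t in (0 : ℝ)..1, (-((1 - t) ^ nbar / ((nbar + 1).factorial : ℝ))) *
      ∑ γ ∈ assignments nbar Γ loc X, ∑ π ∈ setPartitions (univ : Finset (Fin (nbar + 1))),
        ∑' B, pterm R nbar loc g₃ t γ X π B := by
  unfold W6'
  refine intervalIntegral.integral_congr fun t ht => ?_
  rw [Set.uIcc_of_le zero_le_one] at ht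
  congr 1
  exact sum_congr rfl fun γ _ => trunc_eq_sum_tsum_pterm hR hΔ hnbr hθ0 hθ1 hβ hsmall h5144 ht γ X

end PartitionForm

end Literature.MathematicalPhysics.QuantumFieldTheory.BalabanImbrieJaffe1984to88.BIJ88W6PrimeBound

end
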